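import Summits.Parity.BatemanHorn.Theses.AlmostPrimeZeros

/-!
# Disproof work file for the crux `AlmostPrimeZeros.SystemLSDRealSegment` (stmt-Parity-11292) — gen 3

Standing adversary's Lean record (gen 1: refuter-cdisprove-stmt-Parity-11292-0; gen 2: …-g2-0; gen 3: …-g3-0, 2026-08-16,
which EXTENDS the gen-2 file by §7 — nothing above §7 was changed). Everything below is sorry-free; axioms ⊆ {propext,
Classical.choice, Quot.sound}.

LANDED IN THE TREE (importable; namespace `Summit.Parity.BatemanHorn.Theorems.SystemLSDRealSegment.Negative`,
statements there inline the crux body verbatim, no auxiliary `def`s):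
* `Summits/Parity/BatemanHorn/Theorems/SystemLSDRealSegment/Negative/FinZero.lean` (p69552) — §2;
* `…/Negative/DivisorBound.lean` (p69606) — `sum_two_pow_omega_ge`;
* `…/Negative/Engines.lean` (p69751) — §1 engines (`eqOn_ball_of_eqOn_segment`, `tendsto_atTop_of_lower_envelope`, …);
* `…/Negative/LoadBearing.lean` (p70089) — §3; `…/Negative/Structure.lean` (p70085) — §4;
  `…/Negative/OmegaWide.lean` (p70087) — §5. (All six ACCEPTED 2026-08-15.)
* gen 3 (ACCEPTED 2026-08-16): `…/Negative/BetaKernelConstant.lean` (p73264) — §7.2, the `Γ`-inequalities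
  (`Gamma_one_add_pow_le`, `betaKernelConst_nonneg`, `betaKernelConst_pos_of_one_lt`, `typeIShare_le_one`,
  `typeIShare_lt_one`); `…/Negative/BoundedOrderBlind.lean` (p73347) — §7.1 (`tendsto_boundedPart_zero`,
  `tendsto_boundedPart_zero_complex`, `capped_stat_le_of_all_prime`).

INDEX (details in the docstrings)

* §1 the crux restated through the normalised sum `H k f y x` (`crux_iff`, by `Iff.rfl`), its real form `Hr`,
  and the two engines: `eqOn_ball_of_eqOn_segment` / `apply_zero_eq_zero_of_vanish` (identity theorem: the
  segment law pins `Λ` on `ball 0 2`, so `Λ 0 = C(f)` has content; `Λ_unique`) and `not_tendsto_H_of_Hr_atTop` /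
  `tendsto_Hr_atTop_of_lower` (a divisor-type lower bound `Σ y^{s_f} ≥ (x/2) log x - x` kills any limit when
  `k(y-1) < 1`), fed by the elementary `sum_two_pow_omega_ge : (x/2) log x - x ≤ Σ_{n≤x} 2^{ω(n)}`.
* §2 degenerate instance `k = 0` HOLDS (`conclusion_fin_zero`, `lsdLaw_fin_zero`): the empty family is a BH
  system, `C(∅) = 1`, `Λ ≡ 1`.
* §3 LOAD-BEARING ANALYSIS of the four fields of `IsBatemanHornSystem`:
  `false_without_leadingCoeff_pos` (witness `![-X]`), `false_without_irreducible` (witness `![X ^ 2]`, `y = 3/2`),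
  `false_without_pairwise_not_associated` (witness `![X, X]`, `y = 29/20`); `conclusion_C_three` (the junk model
  `![C 3]` with a fixed prime divisor SATISFIES the conclusion, `Λ ≡ 0 = C`): `hasNoFixedPrimeDivisor` is not
  load-bearing for this item (`WithoutNoFixedPrimeDivisor` recorded as OPEN, conjecturally true).
* §4 structure: without holomorphy the `Λ 0`-clause is vacuous (`segmentLaw_update_zero`); positivity passes
  to the limit (`Λ_real_nonneg_of_law`: `Λ(y)` real `≥ 0` on the segment) and Schwarz symmetry
  (`Λ_conj_symm`, `Λ_real_on_diameter`: `Λ` real on `(-2, 2)`).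
* §5 strengthening refuted: the un-capped `Ω` variant is FALSE on any real segment crossing `y = 2`
  (`not_omegaLawWide`, witness `f = X`, `y = 9/4`, `x = 2^m`): the cap `min v 2` is exactly what removes the wall.
* §6 calibration `Hr_one_tendsto` (`H_x(1) → 1`, consistent with `λ_f(1) = 1`), named instances
  (`LinearInstance` = printed theorem, `QuadraticInstance` / `TwinInstance` open) and the docblock
  "Why `SystemLSDRealSegment` resists"; `summary` collects the negative knowledge.
* §6bis (gen 3) NUMERICS ON A NEW AXIS (kit j009357 / j009358): `Γ(y)^{-k}` independence for `k = 3, 4, 6` prime tuples,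
  the same-splitting-field pair `(X²+1, X²+9)` (`D = 4`), the quartic `X⁴+1` — ratios `1 ± 0.05` drifting to 1, every
  alternative normalisation off by factors `1.5–70`; first-order (`y = 1`) check of `log D` via the primes `> x`.
* §7 (gen 3) THE THREE CRUX-PLAN LINES UNDER ATTACK (`Lines/{sign-free-sieve-lab, ewens-pd-kernel,
  beta-thinned-root-kernel}`): stub census (0/15 stub-false), `tendsto_boundedPart_zero` (the law is blind to bounded
  order — it cannot see the prime tuples), the `Γ`-log-convexity consistency of `BetaKernelLaw`'s forced constant
  (`betaKernelConst_nonneg`, `typeIShare_le_one` / `_lt_one`: the Type-I₂ wall as an inequality), and the two kernel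
  stubs as IDENTITIES at `(X)` against verbatim copies of the lines' definitions (`EwensLine.kpd_X`,
  `BetaLine.betaKernelLawAt_X`).
-/

open Filter Polynomial Finset
open scoped Topology BigOperators

namespace Summit.Parity.BatemanHorn.Cruxes.SystemLSDRealSegment.Disproof

open Literature.NumberTheory.Sieve
open Summit.Parity.BatemanHorn.Theses.AlmostPrimeZeros

noncomputable section

/-! ## §1 Restatement and engines -/

/-- The capped almost-prime statistic `s_f(n) = Σ_i Σ_{p^v ∥ f_i(n)} min(v,2)` exactly as typed in the crux
(`f_i(n) ≤ 0 ↦ 0` through `Int.toNat`). [folklore] -/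
def stat {k : ℕ} (f : Fin k → ℤ[X]) (n : ℕ) : ℕ :=
  ∑ i, (((f i).eval (n : ℤ)).toNat.factorization.sum fun _ v => min v 2)

/-- The normalised sum `H_x(y) = x⁻¹ · e^{k(1-y) log log x} · Σ_{n ≤ x} y^{s_f(n)}` of the crux (complex form,
verbatim). [folklore] -/
def H (k : ℕ) (f : Fin k → ℤ[X]) (y : ℝ) (x : ℕ) : ℂ :=
  (x : ℂ)⁻¹ * Complex.exp ((k : ℂ) * (1 - (y : ℂ)) * (Real.log (Real.log x) : ℂ)) *
    ∑ n ∈ Finset.range (x + 1), (y : ℂ) ^ (∑ i, (((f i).eval (n : ℤ)).toNat.factorization.sum fun _ v => min v 2))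

/-- The same normalised sum as a real number. [folklore] -/
def Hr (k : ℕ) (f : Fin k → ℤ[X]) (y : ℝ) (x : ℕ) : ℝ :=
  (x : ℝ)⁻¹ * Real.exp (k * (1 - y) * Real.log (Real.log x)) * ∑ n ∈ Finset.range (x + 1), y ^ stat f n

/-- The archimedean factor `E(y) = e^{(y-1) log D} · Γ(y)^{-k}` of the predicted limit. [folklore] -/
def E (k : ℕ) (f : Fin k → ℤ[X]) (y : ℝ) : ℂ :=
  Complex.exp (((y : ℂ) - 1) * (Real.log (∏ i, ((f i).natDegree : ℝ)) : ℂ)) * (Complex.Gamma y)⁻¹ ^ k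

/-- The conclusion of the crux for one family `(k, f)`: a `Λ` holomorphic on `|z| < 2` with `Λ 0 = C(f)` and the
real-segment law `H_x(y) → Λ(y) E(y)` for `y ∈ (5/4, 7/4)`. [folklore] -/
def Conclusion (k : ℕ) (f : Fin k → ℤ[X]) : Prop :=
  ∃ Λ : ℂ → ℂ, DifferentiableOn ℂ Λ (Metric.ball 0 2) ∧ Λ 0 = (batemanHornConst f : ℂ) ∧
    ∀ y : ℝ, 5 / 4 < y → y < 7 / 4 → Tendsto (H k f y) atTop
      (𝓝 (Λ y * Complex.exp (((y : ℂ) - 1) * (Real.log (∏ i, ((f i).natDegree : ℝ)) : ℂ)) * (Complex.Gamma y)⁻¹ ^ k))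

/-- The crux is literally `∀ k f, IsBatemanHornSystem f → Conclusion k f`. [folklore] -/
theorem crux_iff : SystemLSDRealSegment ↔ ∀ (k : ℕ) (f : Fin k → ℤ[X]), IsBatemanHornSystem f → Conclusion k f :=
  Iff.rfl

/-- `H = Hr` coerced. [folklore] -/
theorem H_eq_ofReal (k : ℕ) (f : Fin k → ℤ[X]) (y : ℝ) (x : ℕ) : H k f y x = ((Hr k f y x : ℝ) : ℂ) := by
  simp only [H, Hr, stat]
  push_cast
  rfl

/-- The predicted limit is `Λ(y) · E(y)`. [folklore] -/
theorem limit_eq (k : ℕ) (f : Fin k → ℤ[X]) (Λ : ℂ → ℂ) (y : ℝ) :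
    Λ y * Complex.exp (((y : ℂ) - 1) * (Real.log (∏ i, ((f i).natDegree : ℝ)) : ℂ)) * (Complex.Gamma y)⁻¹ ^ k =
      Λ y * E k f y := by
  rw [E, mul_assoc]

/-- `E(y) ≠ 0` for `y` on the segment (indeed for `y > 0`). [folklore] -/
theorem E_ne_zero (k : ℕ) (f : Fin k → ℤ[X]) {y : ℝ} (hy : 0 < y) : E k f y ≠ 0 := by
  refine mul_ne_zero (Complex.exp_ne_zero _) (pow_ne_zero _ (inv_ne_zero ?_))
  exact Complex.Gamma_ne_zero_of_re_pos (by simpa using hy)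

/-- Real part of the law: if `H_x(y) → L` then the real normalised sum tends to `re L`. [folklore] -/
theorem tendsto_Hr_re {k : ℕ} {f : Fin k → ℤ[X]} {y : ℝ} {L : ℂ} (h : Tendsto (H k f y) atTop (𝓝 L)) :
    Tendsto (Hr k f y) atTop (𝓝 L.re) := by
  have h' := (Complex.continuous_re.tendsto L).comp h
  refine h'.congr fun x => ?_
  simp [Function.comp, H_eq_ofReal]

/-- ENGINE 1 (divergence): a normalised sum tending to `+∞` has no limit, whatever `Λ(y)` is. [folklore] -/
theorem not_tendsto_H_of_Hr_atTop {k : ℕ} {f : Fin k → ℤ[X]} {y : ℝ} (h0 : Tendsto (Hr k f y) atTop atTop)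
    (L : ℂ) : ¬Tendsto (H k f y) atTop (𝓝 L) := fun h =>
  not_tendsto_atTop_of_tendsto_nhds (tendsto_Hr_re h) h0

/-- If the real normalised sum tends to `0`, the complex limit is `0`. [folklore] -/
theorem limit_eq_zero_of_Hr {k : ℕ} {f : Fin k → ℤ[X]} {y : ℝ} {L : ℂ} (h : Tendsto (H k f y) atTop (𝓝 L))
    (h0 : Tendsto (Hr k f y) atTop (𝓝 0)) : L = 0 := by
  have h1 : Tendsto (H k f y) atTop (𝓝 ((0 : ℝ) : ℂ)) := by
    have := (Complex.continuous_ofReal.tendsto (0 : ℝ)).comp h0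
    refine this.congr fun x => ?_
    simp [Function.comp, H_eq_ofReal]
  simpa using tendsto_nhds_unique h h1

/-- ENGINE 2 (identity theorem): two functions holomorphic on `|z| < 2` that agree at the real points of
`(5/4, 7/4)` agree on the whole ball — the real-segment law PINS `Λ` on `ball 0 2`, in particular `Λ 0`;
so the clause `Λ 0 = batemanHornConst f` is a genuine constraint (no `∃`-slack). [folklore] -/
theorem eqOn_ball_of_eqOn_segment {Λ₁ Λ₂ : ℂ → ℂ} (h₁ : DifferentiableOn ℂ Λ₁ (Metric.ball 0 2))
    (h₂ : DifferentiableOn ℂ Λ₂ (Metric.ball 0 2)) (h : ∀ y : ℝ, 5 / 4 < y → y < 7 / 4 → Λ₁ y = Λ₂ y) :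
    Set.EqOn Λ₁ Λ₂ (Metric.ball 0 2) := by
  have hA₁ : AnalyticOnNhd ℂ Λ₁ (Metric.ball 0 2) := h₁.analyticOnNhd Metric.isOpen_ball
  have hA₂ : AnalyticOnNhd ℂ Λ₂ (Metric.ball 0 2) := h₂.analyticOnNhd Metric.isOpen_ball
  have hpc : IsPreconnected (Metric.ball (0 : ℂ) 2) := (convex_ball 0 2).isPreconnected
  have hz : (((3 : ℝ) / 2 : ℝ) : ℂ) ∈ Metric.ball (0 : ℂ) 2 := by
    rw [Metric.mem_ball, dist_zero_right, Complex.norm_real, Real.norm_eq_abs]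
    rw [abs_of_pos (by norm_num)]
    norm_num
  refine hA₁.eqOn_of_preconnected_of_frequently_eq hA₂ hpc hz ?_
  -- the real points 3/2 + 1/(n+8) of the segment accumulate at 3/2
  set u : ℕ → ℝ := fun n => (3 : ℝ) / 2 + 1 / ((n : ℝ) + 8) with hu
  have hu_t : Tendsto (fun n : ℕ => ((u n : ℝ) : ℂ)) atTop (𝓝[≠] (((3 : ℝ) / 2 : ℝ) : ℂ)) := by
    refine tendsto_nhdsWithin_iff.2 ⟨?_, Eventually.of_forall fun n => ?_⟩
    · have h1 : Tendsto (fun n : ℕ => 1 / ((n : ℝ) + 8)) atTop (𝓝 0) :=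
        tendsto_const_nhds.div_atTop (tendsto_atTop_add_const_right _ _ tendsto_natCast_atTop_atTop)
      have h2 : Tendsto u atTop (𝓝 ((3 : ℝ) / 2)) := by
        simpa [hu] using (tendsto_const_nhds (x := (3 : ℝ) / 2)).add h1
      exact (Complex.continuous_ofReal.tendsto _).comp h2
    · simp only [Set.mem_compl_iff, Set.mem_singleton_iff]
      rw [Complex.ofReal_inj]
      have : (0 : ℝ) < 1 / ((n : ℝ) + 8) := by positivity
      intro heq
      simp only [hu] at heq
      linarith
  refine hu_t.frequently (Eventually.of_forall fun n => h (u n) ?_ ?_).frequently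
  · have : (0 : ℝ) < 1 / ((n : ℝ) + 8) := by positivity
    simp only [hu]; linarith
  · have : 1 / ((n : ℝ) + 8) ≤ 1 / 8 := by
      apply div_le_div_of_nonneg_left (by norm_num) (by norm_num)
      have : (0 : ℝ) ≤ n := Nat.cast_nonneg n
      linarith
    simp only [hu]; linarith

/-- In particular a `Λ` holomorphic on `|z| < 2` that vanishes at the real points of `(5/4, 7/4)` has `Λ 0 = 0`.
[folklore] -/
theorem apply_zero_eq_zero_of_vanish {Λ : ℂ → ℂ} (hΛ : DifferentiableOn ℂ Λ (Metric.ball 0 2))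
    (h : ∀ y : ℝ, 5 / 4 < y → y < 7 / 4 → Λ y = 0) : Λ 0 = 0 := by
  have := eqOn_ball_of_eqOn_segment hΛ (differentiableOn_const (0 : ℂ)) h
  exact this (Metric.mem_ball_self (by norm_num))

/-- UNIQUENESS: two `Λ`'s satisfying the conclusion for the same `(k, f)` coincide on `ball 0 2`. [folklore] -/
theorem Λ_unique {k : ℕ} {f : Fin k → ℤ[X]} {Λ₁ Λ₂ : ℂ → ℂ}
    (h₁ : DifferentiableOn ℂ Λ₁ (Metric.ball 0 2)) (h₂ : DifferentiableOn ℂ Λ₂ (Metric.ball 0 2))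
    (l₁ : ∀ y : ℝ, 5 / 4 < y → y < 7 / 4 → Tendsto (H k f y) atTop (𝓝 (Λ₁ y * E k f y)))
    (l₂ : ∀ y : ℝ, 5 / 4 < y → y < 7 / 4 → Tendsto (H k f y) atTop (𝓝 (Λ₂ y * E k f y))) :
    Set.EqOn Λ₁ Λ₂ (Metric.ball 0 2) := by
  refine eqOn_ball_of_eqOn_segment h₁ h₂ fun y hy hy' => ?_
  have := tendsto_nhds_unique (l₁ y hy hy') (l₂ y hy hy')
  exact mul_right_cancel₀ (E_ne_zero k f (by linarith)) this

/-! ### Elementary limits used by the witnesses -/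

/-- `x⁻¹ (x + 1) → 1`. [folklore] -/
theorem tendsto_inv_mul_succ : Tendsto (fun x : ℕ => (x : ℝ)⁻¹ * (x + 1)) atTop (𝓝 1) := by
  have h : Tendsto (fun x : ℕ => 1 + (x : ℝ)⁻¹) atTop (𝓝 1) := by
    simpa using tendsto_const_nhds.add (tendsto_inv_atTop_nhds_zero_nat (𝕜 := ℝ))
  refine h.congr' ?_
  filter_upwards [eventually_ne_atTop 0] with x hx
  have : (x : ℝ) ≠ 0 := by exact_mod_cast hx
  field_simp

/-- `log log x → +∞` along the naturals. [folklore] -/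
theorem tendsto_loglog_atTop : Tendsto (fun x : ℕ => Real.log (Real.log x)) atTop atTop :=
  Real.tendsto_log_atTop.comp (Real.tendsto_log_atTop.comp tendsto_natCast_atTop_atTop)

/-- The normaliser `e^{k(1-y) log log x}` tends to `0` for `k ≥ 1`, `y > 1`. [folklore] -/
theorem tendsto_normaliser_zero {k : ℕ} (hk : 1 ≤ k) {y : ℝ} (hy : 1 < y) :
    Tendsto (fun x : ℕ => Real.exp (k * (1 - y) * Real.log (Real.log x))) atTop (𝓝 0) := by
  refine Real.tendsto_exp_atBot.comp ?_
  have hneg : (k : ℝ) * (1 - y) < 0 :=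
    mul_neg_of_pos_of_neg (by exact_mod_cast hk) (by linarith)
  exact Tendsto.const_mul_atTop_of_neg hneg tendsto_loglog_atTop

/-- CONSTANT STATISTIC: if `s_f(n) = c` for every `n` then `Hr = x⁻¹(x+1) · e^{k(1-y)LL} · y^c → 0`
(`k ≥ 1`, `y > 1`). Used for `![-X]` (`c = 0`) and `![C 3]` (`c = 1`). [folklore] -/
theorem tendsto_Hr_zero_of_stat_const {k : ℕ} (hk : 1 ≤ k) {f : Fin k → ℤ[X]} {c : ℕ}
    (hc : ∀ n, stat f n = c) {y : ℝ} (hy : 1 < y) : Tendsto (Hr k f y) atTop (𝓝 0) := by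
  have := ((tendsto_inv_mul_succ.mul (tendsto_normaliser_zero hk hy)).mul_const (y ^ c))
  simp only [mul_zero, zero_mul] at this
  refine this.congr fun x => ?_
  simp only [Hr, hc, Finset.sum_const, Finset.card_range, nsmul_eq_mul]
  push_cast
  ring

/-- A real sequence eventually bounded below by `(1/2)(log x)^{b} - 1` with `b > 0` tends to `+∞`. [folklore] -/
theorem tendsto_atTop_of_loglower {u : ℕ → ℝ} {b : ℝ} (hb : 0 < b)
    (h : ∀ᶠ x : ℕ in atTop, 1 / 2 * Real.log x ^ b - 1 ≤ u x) : Tendsto u atTop atTop := by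
  refine tendsto_atTop_mono' atTop h ?_
  have h1 : Tendsto (fun x : ℕ => Real.log x ^ b) atTop atTop :=
    (tendsto_rpow_atTop hb).comp (Real.tendsto_log_atTop.comp tendsto_natCast_atTop_atTop)
  have h2 := (h1.const_mul_atTop (by norm_num : (0 : ℝ) < 1 / 2))
  exact tendsto_atTop_add_const_right _ (-1) h2

/-- `1 < log x` for `x ≥ 3`. [folklore] -/
theorem one_lt_log_of_three_le {x : ℕ} (hx : 3 ≤ x) : 1 < Real.log x := by
  rw [Real.lt_log_iff_exp_lt (by positivity)]
  have := Real.exp_one_lt_d9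
  have h3 : (3 : ℝ) ≤ x := by exact_mod_cast hx
  linarith

/-- ENGINE 1 quantified: a divisor-type lower bound `Σ_{n ≤ x} y^{s_f(n)} ≥ (x/2) log x - x` makes the
normalised sum diverge as soon as `k(y-1) < 1`. [folklore] -/
theorem tendsto_Hr_atTop_of_lower {k : ℕ} {f : Fin k → ℤ[X]} {y : ℝ} (hy : 1 < y)
    (hky : (k : ℝ) * (y - 1) < 1)
    (hlow : ∀ x : ℕ, 3 ≤ x → (x : ℝ) / 2 * Real.log x - x ≤ ∑ n ∈ Finset.range (x + 1), y ^ stat f n) :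
    Tendsto (Hr k f y) atTop atTop := by
  set a : ℝ := k * (1 - y) with ha
  have ha0 : a ≤ 0 := by
    have : (0 : ℝ) ≤ k := Nat.cast_nonneg k
    rw [ha]; nlinarith
  have hb : 0 < a + 1 := by rw [ha]; linarith
  refine tendsto_atTop_of_loglower hb ?_
  filter_upwards [eventually_ge_atTop 3] with x hx
  have hx0 : (0 : ℝ) < x := by exact_mod_cast (show 0 < x by omega)
  have hlog : 1 < Real.log x := one_lt_log_of_three_le hx
  have hlog0 : 0 < Real.log x := by linarith
  have hexp : Real.exp (k * (1 - y) * Real.log (Real.log x)) = Real.log x ^ a := by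
    rw [Real.rpow_def_of_pos hlog0, ha, mul_comm]
  have hS := hlow x hx
  have hpow_le : Real.log x ^ a ≤ 1 := Real.rpow_le_one_of_one_le_of_nonpos hlog.le ha0
  have hpow_pos : 0 < Real.log x ^ a := Real.rpow_pos_of_pos hlog0 a
  calc 1 / 2 * Real.log x ^ (a + 1) - 1
      ≤ 1 / 2 * Real.log x ^ (a + 1) - Real.log x ^ a := by linarith
    _ = Real.log x ^ a * ((x : ℝ)⁻¹ * ((x : ℝ) / 2 * Real.log x - x)) := by
        rw [Real.rpow_add_one hlog0.ne']
        field_simp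
    _ ≤ Real.log x ^ a * ((x : ℝ)⁻¹ * ∑ n ∈ Finset.range (x + 1), y ^ stat f n) := by
        gcongr
    _ = Hr k f y x := by
        rw [Hr, hexp]; ring

/-! ### The divisor-sum lower bound `Σ_{n ≤ x} 2^{ω(n)} ≥ (x/2) log x - x` -/

/-- Squarefree divisors inject into subsets of the prime factors: `#{d ∣ n squarefree} ≤ 2^{ω(n)}`. [folklore] -/
theorem card_sqfree_divisors_le (n : ℕ) : (n.divisors.filter Squarefree).card ≤ 2 ^ n.primeFactors.card := by
  rw [← Finset.card_powerset]
  refine Finset.card_le_card_of_injOn (fun d => d.primeFactors) (fun d hd => ?_) (fun d₁ hd₁ d₂ hd₂ heq => ?_)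
  · rw [Finset.mem_coe, Finset.mem_filter, Nat.mem_divisors] at hd
    rw [Finset.mem_coe, Finset.mem_powerset]
    exact Nat.primeFactors_mono hd.1.1 hd.1.2
  · rw [Finset.mem_coe, Finset.mem_filter] at hd₁ hd₂
    calc d₁ = ∏ p ∈ d₁.primeFactors, p := (Nat.prod_primeFactors_of_squarefree hd₁.2).symm
      _ = ∏ p ∈ d₂.primeFactors, p := by simp only at heq; rw [heq]
      _ = d₂ := Nat.prod_primeFactors_of_squarefree hd₂.2

/-- Double counting: `Σ_{1 ≤ n ≤ x} #{d ∣ n squarefree} = Σ_{d ≤ x squarefree} ⌊x/d⌋`. [folklore] -/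
theorem sum_card_sqfree_divisors (x : ℕ) :
    ∑ n ∈ Icc 1 x, (n.divisors.filter Squarefree).card = ∑ d ∈ (Icc 1 x).filter Squarefree, x / d := by
  have hL : ∀ n ∈ Icc 1 x, (n.divisors.filter Squarefree).card =
      ∑ d ∈ (Icc 1 x).filter Squarefree, if d ∣ n then 1 else 0 := by
    intro n hn
    rw [Finset.mem_Icc] at hn
    rw [← Finset.card_filter]
    congr 1
    ext d
    simp only [Finset.mem_filter, Nat.mem_divisors, Finset.mem_Icc]
    constructor
    · rintro ⟨⟨hd, -⟩, hsq⟩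
      exact ⟨⟨⟨Nat.pos_of_dvd_of_pos hd (by omega), (Nat.le_of_dvd (by omega) hd).trans hn.2⟩, hsq⟩, hd⟩
    · rintro ⟨⟨-, hsq⟩, hd⟩
      exact ⟨⟨hd, by omega⟩, hsq⟩
  have hIcc : Icc 1 x = Ioc 0 x := by
    ext n; simp only [Finset.mem_Icc, Finset.mem_Ioc]; omega
  have hR : ∀ d ∈ (Icc 1 x).filter Squarefree, x / d = ∑ n ∈ Icc 1 x, if d ∣ n then 1 else 0 := by
    intro d _
    rw [← Finset.card_filter, hIcc, Nat.Ioc_filter_dvd_card_eq_div]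
  rw [Finset.sum_congr rfl hL, Finset.sum_congr rfl hR, Finset.sum_comm]

/-- `Σ_{1 ≤ b ≤ x} 1/b² ≤ 2`. [folklore] -/
theorem sum_inv_sq_Icc_le_two (x : ℕ) : ∑ b ∈ Icc 1 x, 1 / (b : ℝ) ^ 2 ≤ 2 := by
  have hsub : Icc 1 x ⊆ insert 1 (Ioo 1 (x + 1)) := by
    intro b hb
    simp only [Finset.mem_insert, Finset.mem_Ioo, Finset.mem_Icc] at hb ⊢
    omega
  have h1 : (1 : ℕ) ∉ Ioo 1 (x + 1) := by simp
  have hIoo : ∑ b ∈ Ioo 1 (x + 1), 1 / (b : ℝ) ^ 2 ≤ 1 := by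
    have := sum_Ioo_inv_sq_le (α := ℝ) 1 (x + 1)
    norm_num at this
    simpa only [one_div] using this
  calc ∑ b ∈ Icc 1 x, 1 / (b : ℝ) ^ 2 ≤ ∑ b ∈ insert 1 (Ioo 1 (x + 1)), 1 / (b : ℝ) ^ 2 :=
        Finset.sum_le_sum_of_subset_of_nonneg hsub fun _ _ _ => by positivity
    _ = 1 + ∑ b ∈ Ioo 1 (x + 1), 1 / (b : ℝ) ^ 2 := by rw [Finset.sum_insert h1]; norm_num
    _ ≤ 1 + 1 := by linarith
    _ = 2 := by norm_num

/-- Writing `n = b² a` with `a` squarefree: `Σ_{n ≤ x} 1/n ≤ 2 Σ_{a ≤ x squarefree} 1/a`. [folklore] -/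
theorem sum_inv_le_two_mul_sum_sqfree_inv (x : ℕ) :
    ∑ n ∈ Icc 1 x, (1 : ℝ) / n ≤ 2 * ∑ d ∈ (Icc 1 x).filter Squarefree, (1 : ℝ) / d := by
  classical
  have hdec : ∀ n : ℕ, ∃ ab : ℕ × ℕ, 0 < n → (0 < ab.1 ∧ 0 < ab.2 ∧ ab.2 ^ 2 * ab.1 = n ∧ Squarefree ab.1) := by
    intro n
    rcases Nat.eq_zero_or_pos n with h | h
    · exact ⟨(1, 1), fun h' => by omega⟩
    · obtain ⟨a, b, ha, hb, hab, hsq⟩ := Nat.sq_mul_squarefree_of_pos h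
      exact ⟨(a, b), fun _ => ⟨ha, hb, hab, hsq⟩⟩
  choose φ hφ using hdec
  set A := (Icc 1 x).filter Squarefree with hA
  set g : ℕ × ℕ → ℝ := fun q => 1 / (q.1 : ℝ) * (1 / (q.2 : ℝ) ^ 2) with hg
  have hmaps : ∀ n ∈ Icc 1 x, φ n ∈ A ×ˢ Icc 1 x := by
    intro n hn
    rw [Finset.mem_Icc] at hn
    obtain ⟨ha, hb, hab, hsq⟩ := hφ n (by omega)
    rw [Finset.mem_product, hA, Finset.mem_filter, Finset.mem_Icc, Finset.mem_Icc]
    refine ⟨⟨⟨ha, ?_⟩, hsq⟩, hb, ?_⟩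
    · calc (φ n).1 ≤ (φ n).2 ^ 2 * (φ n).1 := Nat.le_mul_of_pos_left _ (by positivity)
        _ = n := hab
        _ ≤ x := hn.2
    · calc (φ n).2 ≤ (φ n).2 ^ 2 := Nat.le_self_pow (by norm_num) _
        _ ≤ (φ n).2 ^ 2 * (φ n).1 := Nat.le_mul_of_pos_right _ ha
        _ = n := hab
        _ ≤ x := hn.2
  have hinj : Set.InjOn φ (Icc 1 x : Finset ℕ) := by
    intro n hn m hm heq
    rw [Finset.mem_coe, Finset.mem_Icc] at hn hm
    obtain ⟨-, -, habn, -⟩ := hφ n (by omega)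
    obtain ⟨-, -, habm, -⟩ := hφ m (by omega)
    rw [← habn, ← habm, heq]
  have hterm : ∀ n ∈ Icc 1 x, (1 : ℝ) / n = g (φ n) := by
    intro n hn
    rw [Finset.mem_Icc] at hn
    obtain ⟨ha, hb, hab, -⟩ := hφ n (by omega)
    have ha' : ((φ n).1 : ℝ) ≠ 0 := by exact_mod_cast ha.ne'
    have hb' : ((φ n).2 : ℝ) ≠ 0 := by exact_mod_cast hb.ne'
    have hn' : (n : ℝ) = ((φ n).2 : ℝ) ^ 2 * (φ n).1 := by exact_mod_cast hab.symm
    rw [hg]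
    simp only
    rw [hn']
    field_simp
  calc ∑ n ∈ Icc 1 x, (1 : ℝ) / n = ∑ n ∈ Icc 1 x, g (φ n) := Finset.sum_congr rfl hterm
    _ = ∑ q ∈ (Icc 1 x).image φ, g q := (Finset.sum_image hinj).symm
    _ ≤ ∑ q ∈ A ×ˢ Icc 1 x, g q := by
        apply Finset.sum_le_sum_of_subset_of_nonneg
        · intro q hq
          rw [Finset.mem_image] at hq
          obtain ⟨n, hn, rfl⟩ := hq
          exact hmaps n hn
        · intro q _ _
          rw [hg]; positivity
    _ = (∑ a ∈ A, (1 : ℝ) / a) * ∑ b ∈ Icc 1 x, 1 / (b : ℝ) ^ 2 := by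
        rw [Finset.sum_mul_sum, Finset.sum_product]
    _ ≤ (∑ a ∈ A, (1 : ℝ) / a) * 2 := by
        have : 0 ≤ ∑ a ∈ A, (1 : ℝ) / a := Finset.sum_nonneg fun _ _ => by positivity
        exact mul_le_mul_of_nonneg_left (sum_inv_sq_Icc_le_two x) this
    _ = 2 * ∑ d ∈ A, (1 : ℝ) / d := mul_comm _ _

/-- `log x ≤ Σ_{n ≤ x} 1/n`. [folklore] -/
theorem log_le_sum_inv (x : ℕ) : Real.log x ≤ ∑ n ∈ Icc 1 x, (1 : ℝ) / n := by
  rcases Nat.eq_zero_or_pos x with rfl | hx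
  · simp
  have h := log_add_one_le_harmonic x
  have hmono : Real.log x ≤ Real.log ((x + 1 : ℕ) : ℝ) :=
    Real.log_le_log (by exact_mod_cast hx) (by push_cast; linarith)
  refine hmono.trans (h.trans (le_of_eq ?_))
  rw [harmonic_eq_sum_Icc]
  push_cast
  simp [one_div]

/-- `x/d - 1 ≤ ⌊x/d⌋`. [folklore] -/
theorem sub_one_le_natDiv (a : ℕ) {b : ℕ} (hb : 0 < b) : (a : ℝ) / b - 1 ≤ ((a / b : ℕ) : ℝ) := by
  have h := Nat.lt_div_mul_add (a := a) hb
  have hb' : (0 : ℝ) < b := by exact_mod_cast hb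
  rw [sub_le_iff_le_add, div_le_iff₀ hb']
  have : (a : ℝ) < (a / b : ℕ) * b + b := by exact_mod_cast h
  linarith

/-- THE DIVISOR BOUND: `(x/2) log x - x ≤ Σ_{1 ≤ n ≤ x} 2^{ω(n)}` (crude Dirichlet: `2^{ω(n)} ≥ #` squarefree
divisors, swap, `Σ_{d sqfree} 1/d ≥ ½ Σ 1/n ≥ ½ log x`). [folklore] -/
theorem sum_two_pow_omega_ge (x : ℕ) :
    (x : ℝ) / 2 * Real.log x - x ≤ ∑ n ∈ Icc 1 x, (2 : ℝ) ^ n.primeFactors.card := by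
  set A := (Icc 1 x).filter Squarefree with hA
  have h1 : ∑ n ∈ Icc 1 x, ((n.divisors.filter Squarefree).card : ℝ) ≤
      ∑ n ∈ Icc 1 x, (2 : ℝ) ^ n.primeFactors.card := by
    refine Finset.sum_le_sum fun n _ => ?_
    exact_mod_cast card_sqfree_divisors_le n
  have h2 : ∑ n ∈ Icc 1 x, ((n.divisors.filter Squarefree).card : ℝ) = ∑ d ∈ A, ((x / d : ℕ) : ℝ) := by
    rw [hA]; exact_mod_cast congrArg (Nat.cast : ℕ → ℝ) (sum_card_sqfree_divisors x)
  have h3 : ∑ d ∈ A, ((x : ℝ) / d - 1) ≤ ∑ d ∈ A, ((x / d : ℕ) : ℝ) := by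
    refine Finset.sum_le_sum fun d hd => sub_one_le_natDiv x ?_
    rw [hA, Finset.mem_filter, Finset.mem_Icc] at hd
    omega
  have h4 : ∑ d ∈ A, ((x : ℝ) / d - 1) = x * ∑ d ∈ A, (1 : ℝ) / d - A.card := by
    rw [Finset.sum_sub_distrib, Finset.mul_sum, Finset.sum_const, nsmul_eq_mul, mul_one]
    congr 1
    exact Finset.sum_congr rfl fun d _ => (mul_one_div (x : ℝ) d).symm
  have h5 : (A.card : ℝ) ≤ x := by
    have : A.card ≤ (Icc 1 x).card := Finset.card_filter_le _ _
    simp only [Nat.card_Icc, add_tsub_cancel_right] at this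
    exact_mod_cast this
  have h6 := sum_inv_le_two_mul_sum_sqfree_inv x
  rw [← hA] at h6
  have h7 := log_le_sum_inv x
  have hx0 : (0 : ℝ) ≤ x := Nat.cast_nonneg x
  have h8 : (x : ℝ) / 2 * Real.log x ≤ x * ∑ d ∈ A, (1 : ℝ) / d := by
    have := mul_le_mul_of_nonneg_left (h7.trans h6) (by positivity : (0 : ℝ) ≤ x / 2)
    have e : (x : ℝ) / 2 * (2 * ∑ d ∈ A, (1 : ℝ) / d) = x * ∑ d ∈ A, (1 : ℝ) / d := by ring
    linarith
  linarith

/-- from a real limit to the complex one. [folklore] -/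
theorem tendsto_H_of_Hr {k : ℕ} {f : Fin k → ℤ[X]} {y : ℝ} {L : ℝ} (h : Tendsto (Hr k f y) atTop (𝓝 L)) :
    Tendsto (H k f y) atTop (𝓝 (L : ℂ)) := by
  have := (Complex.continuous_ofReal.tendsto L).comp h
  refine this.congr fun x => ?_
  simp [Function.comp, H_eq_ofReal]

/-! ## §2 The degenerate instance `k = 0` HOLDS -/

/-- `ω_∅(p) = 0`: the empty product is `1`, never divisible by a prime. [folklore] -/
theorem polyRootCountMod_fin_zero (f : Fin 0 → ℤ[X]) {p : ℕ} (hp : p.Prime) : polyRootCountMod f p = 0 := by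
  unfold polyRootCountMod
  simp only [Finset.univ_eq_empty, Finset.prod_empty, Finset.card_eq_zero, Finset.filter_eq_empty_iff]
  intro n _ h
  exact hp.not_dvd_one (by exact_mod_cast h)

/-- The empty family IS a Bateman–Horn system (all four fields vacuous / trivial). [folklore] -/
theorem isBatemanHornSystem_fin_zero (f : Fin 0 → ℤ[X]) : IsBatemanHornSystem f where
  irreducible i := i.elim0
  leadingCoeff_pos i := i.elim0
  pairwise_not_associated i := i.elim0
  hasNoFixedPrimeDivisor p hp := by rw [polyRootCountMod_fin_zero f hp]; exact hp.pos

/-- `C(∅) = 1`: every ordered partial product equals `1`. [folklore] -/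
theorem batemanHornConst_fin_zero (f : Fin 0 → ℤ[X]) : batemanHornConst f = 1 := by
  have : batemanHornPartial f = fun _ => 1 := by
    funext x
    unfold batemanHornPartial
    refine Finset.prod_eq_one fun p hp => ?_
    rw [polyRootCountMod_fin_zero f (Nat.prime_of_mem_primesLE hp)]
    simp
  rw [batemanHornConst, this]
  exact tendsto_const_nhds.limUnder_eq

/-- POSITIVE DEGENERATE CASE: the `k = 0` instance of the crux HOLDS with `Λ ≡ 1`
(`H_x(y) = x⁻¹(x+1) → 1 = 1 · e^{(y-1) log 1} · Γ(y)⁰`, `C(∅) = 1`). No refutation from the empty system;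
a ready-made branch for the prover. [folklore] -/
theorem conclusion_fin_zero (f : Fin 0 → ℤ[X]) : Conclusion 0 f := by
  refine ⟨fun _ => 1, differentiableOn_const 1, by rw [batemanHornConst_fin_zero]; simp, fun y hy hy' => ?_⟩
  have htarget : (1 : ℂ) * Complex.exp (((y : ℂ) - 1) * (Real.log (∏ i : Fin 0, ((f i).natDegree : ℝ)) : ℂ)) *
      (Complex.Gamma y)⁻¹ ^ 0 = ((1 : ℝ) : ℂ) := by simp
  rw [htarget]
  refine tendsto_H_of_Hr (tendsto_inv_mul_succ.congr fun x => ?_)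
  simp [Hr, stat]

/-- Hence `SystemLSDRealSegment` restricted to `k = 0` is TRUE. [folklore] -/
theorem lsdLaw_fin_zero : ∀ f : Fin 0 → ℤ[X], IsBatemanHornSystem f → Conclusion 0 f :=
  fun f _ => conclusion_fin_zero f

/-! ## §3 Load-bearing analysis of the four fields of `IsBatemanHornSystem`

For each field `H` of the hypothesis we state the crux with `H` dropped (`Without…`) and decide it. -/

/-- If `p ∣ ∏ f_i(n) ↔ p ∣ n` for every prime `p` then `ω_f(p) = 1` (only the residue `0`). [folklore] -/
theorem polyRootCountMod_eq_one {k : ℕ} {f : Fin k → ℤ[X]}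
    (hf : ∀ p : ℕ, p.Prime → ∀ n : ℕ, ((p : ℤ) ∣ ∏ i, (f i).eval (n : ℤ)) ↔ p ∣ n)
    {p : ℕ} (hp : p.Prime) : polyRootCountMod f p = 1 := by
  unfold polyRootCountMod
  have : ((Finset.range p).filter fun n : ℕ => (p : ℤ) ∣ ∏ i, (f i).eval (n : ℤ)) = {0} := by
    ext n
    simp only [Finset.mem_filter, Finset.mem_range, Finset.mem_singleton, hf p hp]
    constructor
    · rintro ⟨hn, hdvd⟩
      exact Nat.eq_zero_of_dvd_of_lt hdvd hn
    · rintro rfl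
      exact ⟨hp.pos, dvd_zero p⟩
  rw [this, Finset.card_singleton]

/-- … and then every ordered partial product of a ONE-polynomial family is `1`, so `C(f) = 1`. [folklore] -/
theorem batemanHornConst_eq_one {f : Fin 1 → ℤ[X]} (h : ∀ p : ℕ, p.Prime → polyRootCountMod f p = 1) :
    batemanHornConst f = 1 := by
  have hpart : batemanHornPartial f = fun _ => 1 := by
    funext x
    unfold batemanHornPartial
    refine Finset.prod_eq_one fun p hp => ?_
    have hp' := Nat.prime_of_mem_primesLE hp
    have hp0 : (0 : ℝ) < p := by exact_mod_cast hp'.pos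
    have hlt : 1 / (p : ℝ) < 1 := by rw [div_lt_one hp0]; exact_mod_cast hp'.one_lt
    rw [h p hp', Fintype.card_fin, pow_one, Nat.cast_one]
    exact inv_mul_cancel₀ (by linarith)
  rw [batemanHornConst, hpart]
  exact tendsto_const_nhds.limUnder_eq

/-! ### (a) `leadingCoeff_pos` is load-bearing — witness `![-X]` -/

/-- The crux with the field `leadingCoeff_pos` DROPPED. [folklore] -/
def WithoutLeadingCoeffPos : Prop :=
  ∀ (k : ℕ) (f : Fin k → ℤ[X]), (∀ i, Irreducible (f i)) →
    (Pairwise fun i j => ¬Associated (f i) (f j)) → HasNoFixedPrimeDivisor f → Conclusion k f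

/-- `p ∣ (-X)(n) = -n ↔ p ∣ n`. [folklore] -/
theorem negX_dvd_iff (p : ℕ) (_hp : p.Prime) (n : ℕ) :
    ((p : ℤ) ∣ ∏ i, ((![-X] : Fin 1 → ℤ[X]) i).eval (n : ℤ)) ↔ p ∣ n := by
  simp [Int.natCast_dvd_natCast]

/-- All values of `-X` on `ℕ` are `≤ 0`, so the typed statistic vanishes identically (`Int.toNat`). [folklore] -/
theorem stat_negX (n : ℕ) : stat ![-X] n = 0 := by
  simp [stat]

/-- DROP `leadingCoeff_pos` ⇒ FALSE. Witness `k = 1`, `f = ![-X]` (irreducible: `-X` is prime; `ω(p) = 1 < p`;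
pairwise vacuous): `s_f ≡ 0`, so `H_x(y) = x⁻¹(x+1)(log x)^{1-y} → 0` on the segment, hence `Λ ≡ 0` there
(`E(y) ≠ 0`), hence `Λ 0 = 0` by the identity theorem — but `C(-X) = 1`. The refutation lives on the `toNat`
convention for non-positive values; with `natAbs` the witness would die (then `-X` behaves like `X`). [folklore] -/
theorem false_without_leadingCoeff_pos : ¬WithoutLeadingCoeffPos := by
  intro h
  obtain ⟨Λ, hΛ, hΛ0, hlaw⟩ := h 1 ![-X] (fun i => by simpa using Polynomial.prime_X.neg.irreducible)
    Subsingleton.pairwise (fun p hp => by rw [polyRootCountMod_eq_one negX_dvd_iff hp]; exact hp.one_lt)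
  have hvan : ∀ y : ℝ, 5 / 4 < y → y < 7 / 4 → Λ y = 0 := fun y hy hy' => by
    have hlim := hlaw y hy hy'
    rw [limit_eq] at hlim
    have h0 := limit_eq_zero_of_Hr hlim (tendsto_Hr_zero_of_stat_const le_rfl stat_negX (by linarith))
    exact (mul_eq_zero.1 h0).resolve_right (E_ne_zero 1 _ (by linarith))
  have h0 := apply_zero_eq_zero_of_vanish hΛ hvan
  rw [hΛ0, batemanHornConst_eq_one fun p hp => polyRootCountMod_eq_one negX_dvd_iff hp] at h0
  simp at h0

/-! ### (b) `irreducible` is load-bearing — witness `![X ^ 2]` -/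

/-- The crux with the field `irreducible` DROPPED. [folklore] -/
def WithoutIrreducible : Prop :=
  ∀ (k : ℕ) (f : Fin k → ℤ[X]), (∀ i, 0 < (f i).leadingCoeff) →
    (Pairwise fun i j => ¬Associated (f i) (f j)) → HasNoFixedPrimeDivisor f → Conclusion k f

/-- `p ∣ n² ↔ p ∣ n`. [folklore] -/
theorem sq_dvd_iff (p : ℕ) (hp : p.Prime) (n : ℕ) :
    ((p : ℤ) ∣ ∏ i, ((![X ^ 2] : Fin 1 → ℤ[X]) i).eval (n : ℤ)) ↔ p ∣ n := by
  simp only [Fin.prod_univ_one, Matrix.cons_val_fin_one, eval_pow, eval_X]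
  rw [← Nat.cast_pow, Int.natCast_dvd_natCast]
  exact hp.prime.dvd_pow_iff_dvd two_ne_zero

/-- The CAP in action: `s(n²) = Σ_p min(2 v_p(n), 2) = 2 ω(n)`. [folklore] -/
theorem capped_sq (n : ℕ) : ((n ^ 2).factorization.sum fun _ v => min v 2) = 2 * n.primeFactors.card := by
  rw [Nat.factorization_pow, Finsupp.sum_smul_index' (h := fun _ v => min v 2) (fun _ => rfl), Finsupp.sum,
    Nat.support_factorization, Finset.card_eq_sum_ones, Finset.mul_sum]
  refine Finset.sum_congr rfl fun p hp => ?_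
  have h1 : 0 < n.factorization p := by
    obtain ⟨hp', hpn, hn⟩ := Nat.mem_primeFactors.1 hp
    exact hp'.factorization_pos_of_dvd hn hpn
  simp only [smul_eq_mul]
  omega

/-- `s_{![X²]}(n) = 2 ω(n)`. [folklore] -/
theorem stat_sq (n : ℕ) : stat ![X ^ 2] n = 2 * n.primeFactors.card := by
  simp only [stat, Fin.sum_univ_one, Matrix.cons_val_fin_one, eval_pow, eval_X]
  rw [← Nat.cast_pow, Int.toNat_natCast, capped_sq]

/-- `Σ_{n ≤ x} y^{s(n²)} ≥ Σ_{1 ≤ n ≤ x} 2^{ω(n)}` once `y² ≥ 2`. [folklore] -/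
theorem sum_stat_sq_ge {y : ℝ} (hy : 2 ≤ y ^ 2) (hy0 : 0 ≤ y) (x : ℕ) :
    ∑ n ∈ Icc 1 x, (2 : ℝ) ^ n.primeFactors.card ≤ ∑ n ∈ Finset.range (x + 1), y ^ stat ![X ^ 2] n := by
  calc ∑ n ∈ Icc 1 x, (2 : ℝ) ^ n.primeFactors.card ≤ ∑ n ∈ Icc 1 x, y ^ stat ![X ^ 2] n := by
        refine Finset.sum_le_sum fun n _ => ?_
        rw [stat_sq, pow_mul]
        exact pow_le_pow_left₀ (by norm_num) hy _
    _ ≤ ∑ n ∈ Finset.range (x + 1), y ^ stat ![X ^ 2] n :=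
        Finset.sum_le_sum_of_subset_of_nonneg (fun n hn => by
          simp only [Finset.mem_Icc, Finset.mem_range] at hn ⊢; omega) fun _ _ _ => by positivity

/-- DROP `irreducible` ⇒ FALSE. Witness `k = 1`, `f = ![X²]` (leading coefficient `1 > 0`, `ω(p) = 1 < p`):
`s(n²) = 2ω(n)`, so at `y = 3/2` (`y² = 9/4 ≥ 2`) `Σ_{n≤x} y^{s_f(n)} ≥ Σ 2^{ω(n)} ≥ (x/2) log x - x` and
`H_x(3/2) ≥ ½ (log x)^{1/2} - 1 → ∞`: no limit exists, whatever `Λ`. (Conjectural truth for `X²`: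
`Σ y^{2ω(n)} ~ c·x(log x)^{y²-1}`, exponent `y² - 1 ≠ y - 1`.) [folklore] -/
theorem false_without_irreducible : ¬WithoutIrreducible := by
  intro h
  obtain ⟨Λ, _, _, hlaw⟩ := h 1 ![X ^ 2] (fun i => by simp) Subsingleton.pairwise
    (fun p hp => by rw [polyRootCountMod_eq_one sq_dvd_iff hp]; exact hp.one_lt)
  have hlim := hlaw (3 / 2) (by norm_num) (by norm_num)
  refine not_tendsto_H_of_Hr_atTop ?_ _ hlim
  refine tendsto_Hr_atTop_of_lower (by norm_num) (by norm_num) fun x _ => ?_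
  exact (sum_two_pow_omega_ge x).trans (sum_stat_sq_ge (by norm_num) (by norm_num) x)

/-! ### (c) `pairwise_not_associated` is load-bearing — witness `![X, X]` -/

/-- The crux with the field `pairwise_not_associated` DROPPED. [folklore] -/
def WithoutPairwiseNotAssociated : Prop :=
  ∀ (k : ℕ) (f : Fin k → ℤ[X]), (∀ i, Irreducible (f i)) → (∀ i, 0 < (f i).leadingCoeff) →
    HasNoFixedPrimeDivisor f → Conclusion k f

/-- `p ∣ n·n ↔ p ∣ n`. [folklore] -/
theorem pair_dvd_iff (p : ℕ) (hp : p.Prime) (n : ℕ) :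
    ((p : ℤ) ∣ ∏ i, ((![X, X] : Fin 2 → ℤ[X]) i).eval (n : ℤ)) ↔ p ∣ n := by
  simp only [Fin.prod_univ_two, Matrix.cons_val_zero, Matrix.cons_val_one, eval_X]
  rw [← Nat.cast_mul, Int.natCast_dvd_natCast]
  constructor
  · intro h2; rcases hp.dvd_mul.1 h2 with h2 | h2 <;> exact h2
  · intro h2; exact dvd_mul_of_dvd_left h2 n

/-- The capped statistic dominates `ω`: `Σ_p min(v_p(n), 2) ≥ ω(n)`. [folklore] -/
theorem omega_le_capped (n : ℕ) : n.primeFactors.card ≤ (n.factorization.sum fun _ v => min v 2) := by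
  rw [Finsupp.sum, Nat.support_factorization, Finset.card_eq_sum_ones]
  refine Finset.sum_le_sum fun p hp => ?_
  obtain ⟨hp', hpn, hn⟩ := Nat.mem_primeFactors.1 hp
  have := hp'.factorization_pos_of_dvd hn hpn
  omega

/-- `s_{![X,X]}(n) = 2 s(n)`. [folklore] -/
theorem stat_pair (n : ℕ) : stat ![X, X] n = 2 * (n.factorization.sum fun _ v => min v 2) := by
  simp only [stat, Fin.sum_univ_two, Matrix.cons_val_zero, Matrix.cons_val_one, eval_X, Int.toNat_natCast]
  ring

/-- `Σ_{n ≤ x} y^{2 s(n)} ≥ Σ_{1 ≤ n ≤ x} 2^{ω(n)}` once `y² ≥ 2`, `y ≥ 1`. [folklore] -/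
theorem sum_stat_pair_ge {y : ℝ} (hy : 2 ≤ y ^ 2) (hy1 : 1 ≤ y) (x : ℕ) :
    ∑ n ∈ Icc 1 x, (2 : ℝ) ^ n.primeFactors.card ≤ ∑ n ∈ Finset.range (x + 1), y ^ stat ![X, X] n := by
  calc ∑ n ∈ Icc 1 x, (2 : ℝ) ^ n.primeFactors.card ≤ ∑ n ∈ Icc 1 x, y ^ stat ![X, X] n := by
        refine Finset.sum_le_sum fun n _ => ?_
        calc (2 : ℝ) ^ n.primeFactors.card ≤ (y ^ 2) ^ n.primeFactors.card :=
              pow_le_pow_left₀ (by norm_num) hy _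
          _ = y ^ (2 * n.primeFactors.card) := (pow_mul y 2 _).symm
          _ ≤ y ^ stat ![X, X] n :=
              pow_le_pow_right₀ hy1 (by rw [stat_pair]; have := omega_le_capped n; omega)
    _ ≤ ∑ n ∈ Finset.range (x + 1), y ^ stat ![X, X] n :=
        Finset.sum_le_sum_of_subset_of_nonneg (fun n hn => by
          simp only [Finset.mem_Icc, Finset.mem_range] at hn ⊢; omega) fun _ _ _ => by positivity

/-- DROP `pairwise_not_associated` ⇒ FALSE. Witness `k = 2`, `f = ![X, X]` (both irreducible with leading
coefficient `1`; `ω(p) = 1 < p` — NB `C(X,X) = ∏_p (1-1/p)^{-1} = +∞`, so `batemanHornConst` is junk here and the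
refutation must come from DIVERGENCE, not from `Λ 0`): `s_f(n) = 2 s(n) ≥ 2 ω(n)`, so at `y = 29/20`
(`y² = 841/400 ≥ 2`, `k(y-1) = 9/10 < 1`) `H_x(y) ≥ ½ (log x)^{1/10} - 1 → ∞`. (Conjectural truth:
`Σ y^{2s(n)} ~ c·x(log x)^{y²-1}` vs the normaliser `(log x)^{2(y-1)}`.) [folklore] -/
theorem false_without_pairwise_not_associated : ¬WithoutPairwiseNotAssociated := by
  intro h
  obtain ⟨Λ, _, _, hlaw⟩ := h 2 ![X, X]
    (fun i => by fin_cases i <;> simpa using Polynomial.prime_X.irreducible)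
    (fun i => by fin_cases i <;> simp)
    (fun p hp => by rw [polyRootCountMod_eq_one pair_dvd_iff hp]; exact hp.one_lt)
  have hlim := hlaw (29 / 20) (by norm_num) (by norm_num)
  refine not_tendsto_H_of_Hr_atTop ?_ _ hlim
  refine tendsto_Hr_atTop_of_lower (by norm_num) (by norm_num) fun x _ => ?_
  exact (sum_two_pow_omega_ge x).trans (sum_stat_pair_ge (by norm_num) (by norm_num) x)

/-! ### (d) `hasNoFixedPrimeDivisor` is NOT load-bearing for this item

The crux with `hasNoFixedPrimeDivisor` dropped is (conjecturally) STILL TRUE: a fixed prime divisor `p₀` kills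
the Euler factor at `0` on both sides (`E_{p₀}(0) = P(p₀ ∤ ∏ f_i(n)) = 0` and the partial products of `C(f)`
contain the factor `1 - p₀/p₀ = 0`), so `Λ(0) = 0 = C(f)` consistently, while the segment law keeps its shape
(e.g. `(X, X+1)`: `Λ = λ_f` with `E_2(y) = (y² + …)/2`, `λ_f(0) = 0`). It is only needed DOWNSTREAM (`C(f) > 0`
in `ExtractionAtZero`). We cannot prove the dropped variant (it contains the open law), but the junk model
`![C 3]` below satisfies the three other fields, violates `hasNoFixedPrimeDivisor`, and SATISFIES the conclusion
— so no refutation can come from a fixed prime divisor alone. -/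

/-- The crux with the field `hasNoFixedPrimeDivisor` DROPPED — OPEN, conjecturally TRUE (see above); recorded as
a statement only. [folklore] -/
def WithoutNoFixedPrimeDivisor : Prop :=
  ∀ (k : ℕ) (f : Fin k → ℤ[X]), (∀ i, Irreducible (f i)) → (∀ i, 0 < (f i).leadingCoeff) →
    (Pairwise fun i j => ¬Associated (f i) (f j)) → Conclusion k f

/-- `![C 3]` has the fixed prime divisor `3`: `ω(3) = 3`. [folklore] -/
theorem polyRootCountMod_C_three : polyRootCountMod ![(C 3 : ℤ[X])] 3 = 3 := by
  unfold polyRootCountMod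
  simp

/-- … hence it is NOT a Bateman–Horn system, [folklore] -/
theorem not_hasNoFixedPrimeDivisor_C_three : ¬HasNoFixedPrimeDivisor ![(C 3 : ℤ[X])] := fun h => by
  have := h 3 Nat.prime_three
  rw [polyRootCountMod_C_three] at this
  exact lt_irrefl _ this

/-- … although it satisfies the three other fields (`C 3` is irreducible in `ℤ[X]` since `3` is prime in `ℤ`;
leading coefficient `3 > 0`; pairwise vacuous), [folklore] -/
theorem C_three_other_fields :
    (∀ i, Irreducible ((![(C 3 : ℤ[X])]) i)) ∧ (∀ i, 0 < ((![(C 3 : ℤ[X])]) i).leadingCoeff) ∧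
      Pairwise fun i j => ¬Associated ((![(C 3 : ℤ[X])]) i) ((![(C 3 : ℤ[X])]) j) := by
  refine ⟨fun i => ?_, fun i => ?_, Subsingleton.pairwise⟩
  · simpa using (Polynomial.prime_C_iff.2 Int.prime_three).irreducible
  · simp only [Matrix.cons_val_fin_one, leadingCoeff_C]
    norm_num

/-- … its Bateman–Horn constant is `0` (the partial products vanish from `x = 3` on), [folklore] -/
theorem batemanHornConst_C_three : batemanHornConst ![(C 3 : ℤ[X])] = 0 := by
  refine HasBatemanHornConst.batemanHornConst_eq ?_
  refine (tendsto_const_nhds (x := (0 : ℝ))).congr' ?_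
  filter_upwards [eventually_ge_atTop 3] with x hx
  unfold batemanHornPartial
  symm
  refine Finset.prod_eq_zero (i := 3) (by simp [Nat.mem_primesLE, hx, Nat.prime_three]) ?_
  rw [polyRootCountMod_C_three]
  norm_num

/-- … its statistic is the constant `1` (`s(3) = 1`), [folklore] -/
theorem stat_C_three (n : ℕ) : stat ![(C 3 : ℤ[X])] n = 1 := by
  simp only [stat, Fin.sum_univ_one, Matrix.cons_val_fin_one, eval_C]
  rw [show ((3 : ℤ)).toNat = 3 from rfl, Nat.prime_three.factorization, Finsupp.sum_single_index] <;> simp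

/-- … and it SATISFIES the conclusion of the crux with `Λ ≡ 0` (`H_x(y) = x⁻¹(x+1)(log x)^{1-y} y → 0`,
`C = 0`; `D = natDegree (C 3) = 0` enters only through `log 0 = 0`). So `hasNoFixedPrimeDivisor` is not what
any disproof can lean on. [folklore] -/
theorem conclusion_C_three : Conclusion 1 ![(C 3 : ℤ[X])] := by
  refine ⟨fun _ => 0, differentiableOn_const 0, by rw [batemanHornConst_C_three]; simp, fun y hy _ => ?_⟩
  rw [zero_mul, zero_mul]
  have := tendsto_H_of_Hr (tendsto_Hr_zero_of_stat_const le_rfl stat_C_three (by linarith : (1 : ℝ) < y))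
  simpa using this

/-! ## §4 Structure of the conclusion -/

/-- WITHOUT HOLOMORPHY THE `Λ 0`-CLAUSE IS VACUOUS: from any `Λ` satisfying the segment law and ANY `c`, the
function `update Λ 0 c` satisfies the same law and takes the value `c` at `0` (the segment does not contain `0`).
So it is `DifferentiableOn ℂ Λ (ball 0 2)` (via `eqOn_ball_of_eqOn_segment`) that gives `Λ 0 = C(f)` its teeth:
the crux asserts that the ANALYTIC CONTINUATION of the real-segment law to `0` is the singular series. [folklore] -/
theorem segmentLaw_update_zero {k : ℕ} {f : Fin k → ℤ[X]} {Λ : ℂ → ℂ}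
    (hlaw : ∀ y : ℝ, 5 / 4 < y → y < 7 / 4 → Tendsto (H k f y) atTop (𝓝 (Λ y * E k f y))) (c : ℂ) :
    Function.update Λ 0 c 0 = c ∧
      ∀ y : ℝ, 5 / 4 < y → y < 7 / 4 → Tendsto (H k f y) atTop (𝓝 (Function.update Λ 0 c y * E k f y)) := by
  refine ⟨Function.update_self .., fun y hy hy' => ?_⟩
  have hy0 : (y : ℂ) ≠ 0 := by exact_mod_cast (show y ≠ 0 by linarith)
  rw [Function.update_of_ne hy0]
  exact hlaw y hy hy'

/-- The archimedean factor is a POSITIVE REAL number at real `y > 0`. [folklore] -/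
theorem E_ofReal (k : ℕ) (f : Fin k → ℤ[X]) {y : ℝ} (hy : 0 < y) : ∃ e : ℝ, 0 < e ∧ E k f y = (e : ℂ) := by
  refine ⟨Real.exp ((y - 1) * Real.log (∏ i, ((f i).natDegree : ℝ))) * (Real.Gamma y)⁻¹ ^ k, ?_, ?_⟩
  · have := Real.Gamma_pos_of_pos hy
    positivity
  · rw [E, Complex.Gamma_ofReal]
    push_cast
    ring

/-- The real normalised sum is `≥ 0` (positive weights). [folklore] -/
theorem Hr_nonneg (k : ℕ) (f : Fin k → ℤ[X]) {y : ℝ} (hy : 0 ≤ y) (x : ℕ) : 0 ≤ Hr k f y x := by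
  unfold Hr
  have : 0 ≤ ∑ n ∈ Finset.range (x + 1), y ^ stat f n := Finset.sum_nonneg fun _ _ => pow_nonneg hy _
  positivity

/-- STRUCTURE (positivity passes to the limit): the segment law forces `Λ(y)` to be REAL and `≥ 0` at every
`y ∈ (5/4, 7/4)` (`H_x(y) ≥ 0` real, `E(y) > 0` real). With `Λ_conj_symm` below, `Λ` is real on the whole
diameter `(-2, 2)` — consistent with `Λ(0) = C(f) ∈ ℝ_{>0}` and with `λ_f` having real coefficients. [folklore] -/
theorem Λ_real_nonneg_of_law {k : ℕ} {f : Fin k → ℤ[X]} {Λ : ℂ → ℂ}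
    (hlaw : ∀ y : ℝ, 5 / 4 < y → y < 7 / 4 → Tendsto (H k f y) atTop (𝓝 (Λ y * E k f y)))
    {y : ℝ} (hy : 5 / 4 < y) (hy' : y < 7 / 4) : (Λ y).im = 0 ∧ 0 ≤ (Λ y).re := by
  obtain ⟨e, he, hE⟩ := E_ofReal k f (by linarith : (0 : ℝ) < y)
  have hlim := hlaw y hy hy'
  rw [hE] at hlim
  have him : (Λ y * e).im = 0 := by
    have h1 := (Complex.continuous_im.tendsto _).comp hlim
    have h2 : Tendsto (fun x => (H k f y x).im) atTop (𝓝 0) := by simp [H_eq_ofReal]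
    exact tendsto_nhds_unique h1 h2
  have hre : 0 ≤ (Λ y * e).re :=
    ge_of_tendsto' (tendsto_Hr_re hlim) fun x => Hr_nonneg k f (by linarith) x
  rw [Complex.mul_im, Complex.ofReal_re, Complex.ofReal_im, mul_zero, zero_add] at him
  rw [Complex.mul_re, Complex.ofReal_re, Complex.ofReal_im, mul_zero, sub_zero] at hre
  exact ⟨(mul_eq_zero.1 him).resolve_right he.ne', (mul_nonneg_iff_of_pos_right he).1 hre⟩

/-- SCHWARZ SYMMETRY: a `Λ` holomorphic on `|z| < 2` and real on the segment satisfies `Λ(conj z) = conj Λ(z)`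
on the ball (identity theorem applied to `z ↦ conj Λ(conj z)`); in particular `Λ(t) ∈ ℝ` for real `|t| < 2`.
[folklore] -/
theorem Λ_conj_symm {Λ : ℂ → ℂ} (hΛ : DifferentiableOn ℂ Λ (Metric.ball 0 2))
    (hreal : ∀ y : ℝ, 5 / 4 < y → y < 7 / 4 → (Λ y).im = 0) :
    Set.EqOn Λ (fun z => starRingEnd ℂ (Λ (starRingEnd ℂ z))) (Metric.ball 0 2) := by
  have hball : ∀ z : ℂ, z ∈ Metric.ball (0 : ℂ) 2 → starRingEnd ℂ z ∈ Metric.ball (0 : ℂ) 2 := fun z hz => by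
    simpa [Metric.mem_ball, dist_zero_right, Complex.norm_conj] using hz
  have h₂ : DifferentiableOn ℂ (fun z => starRingEnd ℂ (Λ (starRingEnd ℂ z))) (Metric.ball 0 2) := by
    intro z hz
    have hd : DifferentiableAt ℂ Λ (starRingEnd ℂ z) :=
      (hΛ _ (hball z hz)).differentiableAt (Metric.isOpen_ball.mem_nhds (hball z hz))
    have h2 := hd.conj_conj
    rw [Complex.conj_conj] at h2
    exact h2.differentiableWithinAt
  refine eqOn_ball_of_eqOn_segment hΛ h₂ fun y hy hy' => ?_
  simp only [Complex.conj_ofReal]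
  exact (Complex.conj_eq_iff_im.2 (hreal y hy hy')).symm

/-- Consequence: under the segment law, `Λ(t)` is real for every real `t ∈ (-2, 2)`. [folklore] -/
theorem Λ_real_on_diameter {k : ℕ} {f : Fin k → ℤ[X]} {Λ : ℂ → ℂ} (hΛ : DifferentiableOn ℂ Λ (Metric.ball 0 2))
    (hlaw : ∀ y : ℝ, 5 / 4 < y → y < 7 / 4 → Tendsto (H k f y) atTop (𝓝 (Λ y * E k f y)))
    {t : ℝ} (ht : |t| < 2) : (Λ t).im = 0 := by
  have hsym := Λ_conj_symm hΛ fun y hy hy' => (Λ_real_nonneg_of_law hlaw hy hy').1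
  have hmem : ((t : ℝ) : ℂ) ∈ Metric.ball (0 : ℂ) 2 := by
    simpa [Metric.mem_ball, dist_zero_right, Complex.norm_real] using ht
  have := hsym hmem
  simp only [Complex.conj_ofReal] at this
  exact Complex.conj_eq_iff_im.1 this.symm

/-! ## §5 Natural strengthenings refuted

### (a) Removing the cap AND letting the segment cross `y = 2` is FALSE (witness `f = X`)

The capped statistic has polynomial Euler factors `E_p(y)` (degree `≤ 2k`), so for the CRUX ITSELF nothing
special happens at `y = 2` (for `f = X` the law holds for every real `y > 0`, MV Thm 7.18 with every `R`).
For the un-capped `Ω` the `p = 2` factor `Σ_v y^v 2^{-v}` has a pole at `y = 2`: on `(5/4, 7/4)` the Ω-law is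
still conjecturally true (sibling crux `SelbergDelangeRigidity.LSDRealSegment`, stmt-Parity-9770), but as soon as
the segment reaches beyond `2` it is false — already for `f = X`, by the single term `n = 2^m`. This is the
design reason for the cap, now a theorem. -/

/-- The UN-capped statistic `Ω_f(n) = Σ_i Ω(f_i(n))` (full multiplicity; `f_i(n) ≤ 0 ↦ 0`). [folklore] -/
def statΩ {k : ℕ} (f : Fin k → ℤ[X]) (n : ℕ) : ℕ :=
  ∑ i, (((f i).eval (n : ℤ)).toNat.factorization.sum fun _ v => v)

/-- Its normalised sum, real form. [folklore] -/
def HΩr (k : ℕ) (f : Fin k → ℤ[X]) (y : ℝ) (x : ℕ) : ℝ :=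
  (x : ℝ)⁻¹ * Real.exp (k * (1 - y) * Real.log (Real.log x)) * ∑ n ∈ Finset.range (x + 1), y ^ statΩ f n

/-- STRENGTHENING (Ω, wide segment): the crux with `min v 2` replaced by `v` and the segment `(5/4, 7/4)`
replaced by `(5/4, 5/2)` (ball radius `3`). [folklore] -/
def OmegaLawWide : Prop :=
  ∀ (k : ℕ) (f : Fin k → ℤ[X]), IsBatemanHornSystem f → ∃ Λ : ℂ → ℂ, DifferentiableOn ℂ Λ (Metric.ball 0 3) ∧
    Λ 0 = (batemanHornConst f : ℂ) ∧ ∀ y : ℝ, 5 / 4 < y → y < 5 / 2 →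
      Tendsto (fun x : ℕ => (x : ℂ)⁻¹ * Complex.exp ((k : ℂ) * (1 - (y : ℂ)) * (Real.log (Real.log x) : ℂ)) *
        ∑ n ∈ Finset.range (x + 1), (y : ℂ) ^ (∑ i, (((f i).eval (n : ℤ)).toNat.factorization.sum fun _ v => v)))
        atTop (𝓝 (Λ y * Complex.exp (((y : ℂ) - 1) * (Real.log (∏ i, ((f i).natDegree : ℝ)) : ℂ)) *
          (Complex.Gamma y)⁻¹ ^ k))

/-- `p ∣ X(n) = n ↔ p ∣ n`. [folklore] -/
theorem X_dvd_iff (p : ℕ) (_hp : p.Prime) (n : ℕ) :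
    ((p : ℤ) ∣ ∏ i, ((![X] : Fin 1 → ℤ[X]) i).eval (n : ℤ)) ↔ p ∣ n := by
  simp [Int.natCast_dvd_natCast]

/-- `![X]` is a Bateman–Horn system. [folklore] -/
theorem isBatemanHornSystem_X : IsBatemanHornSystem (![X] : Fin 1 → ℤ[X]) where
  irreducible i := by simpa using Polynomial.prime_X.irreducible
  leadingCoeff_pos i := by simp
  pairwise_not_associated := Subsingleton.pairwise
  hasNoFixedPrimeDivisor p hp := by rw [polyRootCountMod_eq_one X_dvd_iff hp]; exact hp.one_lt

/-- `Ω(2^m) = m`. [folklore] -/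
theorem statΩ_X_two_pow (m : ℕ) : statΩ ![X] (2 ^ m) = m := by
  simp only [statΩ, Fin.sum_univ_one, Matrix.cons_val_fin_one, eval_X, Int.toNat_natCast]
  rw [Nat.prime_two.factorization_pow, Finsupp.sum_single_index rfl]

/-- Lower bound along `x = 2^m` at `y = 9/4`: `HΩr ≥ (9/8)^m / (m log 2)²` (keep the single term `n = 2^m`,
and `(log 2^m)^{1-y} = (m log 2)^{-5/4} ≥ (m log 2)^{-2}`). [folklore] -/
theorem HΩr_X_two_pow_ge {m : ℕ} (hm : 2 ≤ m) :
    (9 / 8 : ℝ) ^ m / ((m : ℝ) * Real.log 2) ^ 2 ≤ HΩr 1 ![X] (9 / 4) (2 ^ m) := by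
  have hlog2 : (1 : ℝ) / 2 < Real.log 2 := by have := Real.log_two_gt_d9; linarith
  have hm' : (2 : ℝ) ≤ m := by exact_mod_cast hm
  have ht : 1 ≤ (m : ℝ) * Real.log 2 := by nlinarith
  have ht0 : 0 < (m : ℝ) * Real.log 2 := by linarith
  have hlogpow : Real.log ((2 ^ m : ℕ) : ℝ) = m * Real.log 2 := by push_cast; rw [Real.log_pow]
  -- the normaliser
  have hexp : Real.exp ((1 : ℕ) * (1 - (9 / 4 : ℝ)) * Real.log (Real.log ((2 ^ m : ℕ) : ℝ))) =
      ((m : ℝ) * Real.log 2) ^ (-(5 / 4) : ℝ) := by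
    rw [hlogpow, Real.rpow_def_of_pos ht0]
    congr 1
    push_cast
    ring
  have hexp_ge : (((m : ℝ) * Real.log 2) ^ 2)⁻¹ ≤ ((m : ℝ) * Real.log 2) ^ (-(5 / 4) : ℝ) := by
    rw [← Real.rpow_natCast, ← Real.rpow_neg ht0.le]
    exact Real.rpow_le_rpow_of_exponent_le ht (by norm_num)
  -- the sum: keep the term n = 2^m
  have hsum : (9 / 4 : ℝ) ^ m ≤ ∑ n ∈ Finset.range (2 ^ m + 1), (9 / 4 : ℝ) ^ statΩ ![X] n := by
    have := Finset.single_le_sum (f := fun n => (9 / 4 : ℝ) ^ statΩ ![X] n) (fun _ _ => by positivity)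
      (Finset.mem_range.2 (Nat.lt_succ_self (2 ^ m)))
    simpa [statΩ_X_two_pow] using this
  have hx : ((2 ^ m : ℕ) : ℝ)⁻¹ = (1 / 2 : ℝ) ^ m := by push_cast; simp
  calc (9 / 8 : ℝ) ^ m / ((m : ℝ) * Real.log 2) ^ 2
      = (1 / 2 : ℝ) ^ m * (((m : ℝ) * Real.log 2) ^ 2)⁻¹ * (9 / 4 : ℝ) ^ m := by
        rw [div_eq_mul_inv, show (9 / 8 : ℝ) = 1 / 2 * (9 / 4) by norm_num, mul_pow]; ring
    _ ≤ (1 / 2 : ℝ) ^ m * ((m : ℝ) * Real.log 2) ^ (-(5 / 4) : ℝ) *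
          ∑ n ∈ Finset.range (2 ^ m + 1), (9 / 4 : ℝ) ^ statΩ ![X] n := by
        gcongr
    _ = HΩr 1 ![X] (9 / 4) (2 ^ m) := by
        rw [HΩr, hx, hexp]

/-- `(9/8)^m / (m log 2)² → ∞`. [folklore] -/
theorem tendsto_geom_div_sq : Tendsto (fun m : ℕ => (9 / 8 : ℝ) ^ m / ((m : ℝ) * Real.log 2) ^ 2) atTop atTop := by
  have h0 : Tendsto (fun m : ℕ => (m : ℝ) ^ 2 / (9 / 8 : ℝ) ^ m) atTop (𝓝[>] 0) := by
    refine tendsto_nhdsWithin_iff.2 ⟨tendsto_pow_const_div_const_pow_of_one_lt 2 (by norm_num), ?_⟩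
    filter_upwards [eventually_ge_atTop 1] with m hm
    simp only [Set.mem_Ioi]
    positivity
  have h1 := h0.inv_tendsto_nhdsGT_zero
  have h2 := h1.const_mul_atTop (by have := Real.log_two_gt_d9; positivity : (0 : ℝ) < (Real.log 2 ^ 2)⁻¹)
  refine h2.congr' ?_
  filter_upwards [eventually_ge_atTop 1] with m hm
  have hm0 : (m : ℝ) ≠ 0 := by exact_mod_cast (show m ≠ 0 by omega)
  have hl : Real.log 2 ≠ 0 := by have := Real.log_two_gt_d9; positivity
  simp only [Pi.inv_apply]
  field_simp

/-- The Ω-normalised sum of `OmegaLawWide` is `HΩr` coerced. [folklore] -/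
theorem HΩ_eq_ofReal (k : ℕ) (f : Fin k → ℤ[X]) (y : ℝ) (x : ℕ) :
    (x : ℂ)⁻¹ * Complex.exp ((k : ℂ) * (1 - (y : ℂ)) * (Real.log (Real.log x) : ℂ)) *
        ∑ n ∈ Finset.range (x + 1), (y : ℂ) ^ (∑ i, (((f i).eval (n : ℤ)).toNat.factorization.sum fun _ v => v))
      = ((HΩr k f y x : ℝ) : ℂ) := by
  simp only [HΩr, statΩ]
  push_cast
  rfl

/-- THE Ω-VARIANT ON A SEGMENT CROSSING 2 IS FALSE: witness `k = 1`, `f = ![X]`, `y = 9/4`, `x = 2^m`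
(`HΩr(2^m) ≥ (9/8)^m/(m log 2)² → ∞` contradicts convergence along the subsequence). [folklore] -/
theorem not_omegaLawWide : ¬OmegaLawWide := by
  intro h
  obtain ⟨Λ, _, _, hlaw⟩ := h 1 ![X] isBatemanHornSystem_X
  have hlim := (hlaw (9 / 4) (by norm_num) (by norm_num)).congr fun x => HΩ_eq_ofReal 1 ![X] (9 / 4) x
  -- real form of the sequence
  obtain ⟨L, hre⟩ : ∃ L : ℝ, Tendsto (HΩr 1 ![X] (9 / 4)) atTop (𝓝 L) :=
    ⟨_, ((Complex.continuous_re.tendsto _).comp hlim).congr fun x => by simp⟩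
  have h2m : Tendsto (fun m : ℕ => 2 ^ m) atTop atTop := tendsto_pow_atTop_atTop_of_one_lt one_lt_two
  have hsub := hre.comp h2m
  refine not_tendsto_atTop_of_tendsto_nhds hsub ?_
  refine tendsto_atTop_mono' atTop ?_ tendsto_geom_div_sq
  filter_upwards [eventually_ge_atTop 2] with m hm
  exact HΩr_X_two_pow_ge hm

/-! ## §6 Calibrations, named instances, and WHY THE CRUX ITSELF RESISTS

### Calibration at `y = 1`
-/

/-- At `y = 1` every weight is `1`: `H_x(1) = x⁻¹(x+1) → 1` for EVERY family. The crux does not ask `y = 1`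
(`1 ∉ (5/4, 7/4)`), but `Λ(1)` is pinned by analytic continuation, and the conjectured `Λ = λ_f` has
`λ_f(1) = ∏_p E_p(1)(1-1/p)^0 = 1` — consistent (a law that extended continuously to `y = 1` would FORCE
`Λ(1) = 1`, since `E(1) = 1`). [folklore] -/
theorem Hr_one_tendsto (k : ℕ) (f : Fin k → ℤ[X]) : Tendsto (Hr k f 1) atTop (𝓝 1) := by
  refine tendsto_inv_mul_succ.congr fun x => ?_
  simp [Hr]

/-! ### Named instances (targets for provers; statuses in the docstrings) -/

/-- INSTANCE `k = 1`, `f = X` — TRUE IN PRINT (Selberg–Delange for the TW-class multiplicative function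
`y^{s(n)}`, `g(p) = y`, `g(p^v) = y²`: Montgomery–Vaughan 2007 Thm 7.18 = tree fact
`Literature.NumberTheory.LFunctions.MontgomeryVaughan2007_thm_7_18`, every `R ≥ 1` because the cap makes the
Euler factor `1 + O(p^{-2σ})`; `Λ = λ(z) = ∏_p [(1-1/p)(1+z/p) + z²/p²](1-1/p)^{z-1}` entire, `λ(0) = 1 = C(X)`,
`D = 1`). The prover's entry point; not refutable. [cite: MontgomeryVaughan2007, Thm 7.18] -/
def LinearInstance : Prop := Conclusion 1 ![X]

/-- INSTANCE `k = 1`, `f = X² + 1` — OPEN (first case with `D = 2`; needs the joint law of the prime factors of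
`n² + 1` beyond level `x`, i.e. divisor data of `n²+1` with complex/real weights `y ∈ (5/4,7/4)`; only Hooley's
`y = 2`-type `Σ τ(n²+1) ~ (3/π) x log x` is known, and it matches the model's `D`-factor exactly). Numerics
(evidence `lsd_check_results_1e6.json`, jobs j002886/j003079/j003132 on the item): measured/predicted
`1.0025 / 1.012 / 1.027` at `y = 1.3 / 1.5 / 1.7`, `x = 10⁶`, drifting to `1`. [cite: Hooley1963] -/
def QuadraticInstance : Prop := Conclusion 1 ![X ^ 2 + 1]

/-- INSTANCE `k = 2`, `f = (X, X+2)` — OPEN (shifted-convolution of `d_y`-type functions; the `Γ(y)^{-2}`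
factor = independence of the large prime factors of `n` and `n+2`, validated at `y = 2` with `τ` by Ingham's
`Σ τ(n)τ(n+2)`-type asymptotics). Numerics: `0.990 / 1.000 / 1.028` at `x = 10⁶`. [folklore] -/
def TwinInstance : Prop := Conclusion 2 ![X, X + 2]

/-! ### Why `SystemLSDRealSegment` resists (gen 2 summary for provers / planners)

1. FAITHFUL HEURISTIC. Model `f_i(n)` (`n ≤ x`) as independent random integers of size `x^{d_i}` with the joint
   local laws `E_p(y) = lim N⁻¹ Σ_{n<N} y^{s_{f,p}(n)}` (a polynomial of degree `≤ 2k` in `y` — the cap) and the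
   universal Poisson–Dirichlet correction `e^{γ(y-1)}/Γ(y)` per polynomial for the dependence among LARGE prime
   factors. Since `Σ_{p ≤ z} ρ_i(p)/p = log log z + c_i + o(1)` (prime ideal theorem), the primes in
   `(x, x^{d_i}]` contribute `d_i^{y-1}`, whence
   `x⁻¹ Σ_{n≤x} y^{s_f(n)} ≈ λ_f(y) (log x)^{k(y-1)} D^{y-1} Γ(y)^{-k}`, `λ_f(y) = ∏_p E_p(y)(1-1/p)^{k(y-1)}`
   (ordered product, locally uniformly convergent by `AZFG2020_tendsto_sum_sub_omega_div_holds`, so entire),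
   `λ_f(0) = ∏_p (1 - ω_f(p)/p)(1-1/p)^{-k}` in the SAME increasing-`p` order as `batemanHornPartial`
   `= batemanHornConst f`, `λ_f(1) = 1`. Every rigid constant of the typed statement (`(log x)^{k(1-y)}`,
   `D^{y-1}` with `D = ∏ natDegree` — degree, not size: `2X+1` gives `Λ(0) = 2 = C` —, `Γ^{-k}`, `Λ(0) = C(f)`)
   is the one this model predicts; alternatives are excluded numerically by 19–74 % (no `D`) / 5–48 % (Kubilius
   `e^{γ(y-1)}` instead of `1/Γ`) (item notes 17:15–17:33Z).
2. KNOWN CASES ARE TRUE. `k = 0`: `conclusion_fin_zero` above. `k = 1` linear `aX+b`: Selberg–Delange in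
   progressions, `Λ(0) = a/φ(a) = C`. Model checks against THEOREMS outside the statistic: Hooley (`τ(n²+1)`,
   the `D = 2` factor), Ingham/Estermann (`Σ τ(n)τ(n+1) ~ (6/π²) x log² x` = the `k = 2` model at `y = 2`:
   `∏_p (1 + 2/(p-1))(1-1/p)² = 6/π²`, `Γ(2)^{-2} = 1`).
3. NO CHEAP KILL EXISTS. The statement is asymptotic (no finite computation refutes it); degenerate parameters
   are either excluded by `IsBatemanHornSystem` (§3: three of the four fields are load-bearing, each with a Lean
   witness) or consistent (`k = 0`; fixed prime divisor ⇒ `0 = 0`); the `∃Λ` has no slack but its pin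
   `Λ(0) = C(f)` is exactly what the Euler product predicts; positive weights `y > 1` mean no parity/sign
   cancellation is asked, so the Parity barriers (`Literature/Barriers/Parity/*`: Selberg parity, Ford–Maynard,
   Friedlander–Granville uniformity) do not bite a FIXED system on the real segment; `ledger negatives
   --problem Parity` has nothing on LSD laws.
4. WHAT A DISPROOF WOULD NEED. Either (i) a system where the real-segment limit provably fails to exist — this
   requires the prime factors of `f_i(n)` beyond level `x` to deviate from Poisson–Dirichlet at a POSITIVE-weight
   level (contradicting Dickman-type conjectures of Martin 2002 / Dartyge–Martin–Tenenbaum 2001, and for `k = 1`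
   linear contradicting a theorem), or (ii) existence with a limit whose analytic continuation to `0` is not
   `C(f)` — given the normal-family input of the route this is equivalent to ¬Bateman–Horn for that `f`.
   Neither is accessible; the honest status is OPEN for `deg ≥ 2` or `k ≥ 2` (Type-I₂ wall: divisor data of
   `f(n)` beyond level `x^{1+δ}`, DFI/Tóth only reach `x^{1+δ}` for quadratics).
   EXTERNAL STATUS (gen 3, page-read): C. Dartyge, *Friable integers: an overview* (EMS; galaxy
   pdf:6121128649703650580), §4.2 p. 11: the conjectures on friable values "in polynomial sequences … are currently
   out of reach"; what exists is for BINARY FORMS (Balog–Blomer–Dartyge–Tenenbaum lower bounds for `Ψ_F(x, y)`,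
   `y ≥ x^{deg F - 2 + ε}`; Lachand: asymptotics for cubic / products of linear forms with `y = x^{o(1)}`) — i.e. the
   un-tilted (`y`-free) shadow of this crux is itself open for one-variable polynomials of degree `≥ 2`, and no
   counterexample to the Dickman/Poisson–Dirichlet prediction along polynomial values is on record.
   For `deg fᵢ ≥ 4` the crux moreover contains a tilted, averaged form of "square divisors `p² ∣ fᵢ(n)` with
   `p > x` are sparse" (Granville 1998 under ABC; unconditional only for `deg ≤ 3`: Erdős 1953 / Hooley 1967) —
   inherent in the pin `Λ(0) = C(f)`, flagged by line `ewens-pd-kernel`; believed, not refutable.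
5. DESIGN FACTS NOW THEOREMS. The cap matters exactly at `y = 2` (`not_omegaLawWide`); holomorphy is what gives
   `Λ(0) = C(f)` content (`segmentLaw_update_zero`, `eqOn_ball_of_eqOn_segment`); the `toNat` convention is what
   makes `leadingCoeff_pos` load-bearing (`false_without_leadingCoeff_pos`).
-/


/-! ### §6bis (gen 3) Numerics on a NEW AXIS — `Γ(y)^{-k}` independence for `k = 3, 4, 6`, a same-splitting-field pair,
a quartic (kit j009357, N = 3·10⁵ / quartic N = 10⁴, 1.2 s; the `x ≤ 10⁷` run j009358 is queued and auto-attaches to the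
item as `compute-j009358.json`; script `compute/tuples_lsd.py` of the g3 seat, local factors `E_p` brute-force-checked).

`ratio = H_x(y) / [λ_f(y) D^{y-1} Γ(y)^{-k}]` (crux: `→ 1`), `λ_f` = ordered Euler product to `P = 3·10⁵`; `y = 1.3 / 1.5 / 1.7`;
`Δ₁ := mean(s_f) - k log log x` against its first-order prediction `λ_f'(1) + kγ + log D` (`compute/deriv_at_one.py`).

| system (k, D)                        | x    | ratio 1.3 / 1.5 / 1.7      | trend 10⁴→10⁵ | Δ₁ meas. / pred. |
|--------------------------------------|------|----------------------------|---------------|------------------|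
| `X` (1, 1) — theorem case            | 10⁵  | 0.991 / 0.989 / 0.992      | ↑ to 1        | 0.672 / 0.714    |
| `(X, X+2)` (2, 1) — old data ✓       | 10⁵  | 0.988 / 1.000 / 1.032      | → 1           | 1.344 / 1.428    |
| `(X, X+2, X+6)` (3, 1) NEW           | 10⁵  | 0.975 / 0.990 / 1.041      | → 1 both sides| 2.016 / 2.141    |
| `(X, X+2, X+6, X+8)` (4, 1) NEW      | 10⁵  | 0.973 / 1.012 / 1.123      | → 1 both sides| 2.688 / 2.855    |
| 6-tuple `{0,4,6,10,12,16}` (6, 1) NEW| 10⁵  | 0.943 / 1.009 / 1.207      | → 1 both sides| 4.033 / 4.283    |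
| `X²+1` (1, 2) — old data ✓           | 10⁵  | 1.003 / 1.014 / 1.033      | ↓ to 1        | 0.711 / 0.727    |
| `(X²+1, X²+9)` (2, 4) NEW same field | 10⁵  | 0.997 / 1.015 / 1.051      | ↓ to 1        | 2.054 / 2.121    |
| `X⁴+1` (1, 4) NEW quartic            | 10⁴  | 1.001 / 1.011 / 1.029      | —             | 0.733 / 0.760    |

ALTERNATIVES EXCLUDED at the same `x` (columns `diag` of the job): the Type-I constant `λ_f(y)/Γ(k(y-1)+1)` (no kernel) gives
3.02 / 12.5 / 69.9 for the 6-tuple, 1.68 / 2.58 / 4.17 for the same-field pair, 1.52 / 2.02 / 2.72 for the quartic; dropping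
`Γ(y)^{-k}` gives 1.80 / 2.08 / 2.15 (6-tuple); dropping `D^{y-1}` gives 1.51 / 2.03 / 2.77 (pair, `D = 4`) and
`4^{y-1}` = 1.52 / 2.02 / 2.72 off for the quartic — while the crux's normalisation sits at `1 ± 0.05` (`± 0.21` at `k = 6`,
`y = 1.7`, where six `O(1/log x)` finite-size corrections compound; the deviation shrinks from 10⁴ to 10⁵ on BOTH sides of 1).
FIRST-ORDER CHECK (`y`-derivative at 1): `Δ₁ → λ_f'(1) + kγ + log D`, the `log D` being carried by the primes `> x`
(Dickman along `f`: `E #{p > x : p ∣ ∏ fᵢ(n)} → log D`); measured values approach the predictions from below uniformly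
(deficit ≈ 0.04–0.05 per coordinate at 10⁵); for the quartic the small-prime part alone predicts `-0.63` against the
measured `0.73` = `-0.63 + log 4` ✓ — the `D^{y-1}` factor is the exponentiated form of a constant already visible (and
already OPEN for `deg ≥ 2`: density of `P⁺(n²+1) > x` → `log 2`) in the MEAN of `s_f`.
RATE (the sharpest check): the deviations obey `ratio - 1 = c_f(y)/log x` to within the noise — the constant fitted at `10⁴`
equals the one at `10⁵` in every cell (e.g. `X²+1`: `c = 0.035/0.162/0.376` vs `0.035/0.162/0.375`; 6-tuple `y = 1.7`:
`2.33` vs `2.39`), and the fit PREDICTS the `10⁶` data of the earlier seats out of sample to three decimals (`X²+1`: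
predicted 1.0025/1.0117/1.0271, measured 1.0025/1.012/1.027 (j002886); `(X, X+2)`: predicted 0.990/1.000/1.027, measured
0.990/1.000/1.028). So `H_x(y) = λ_f(y)D^{y-1}Γ(y)^{-k}(1 + c_f(y)/log x + o(1/log x))` numerically — the shape of a
Selberg–Delange expansion with a secondary term (as MV Thm 7.18 gives for `f = X`), for every system tested. Predictions
for the queued `10⁷` run (j009358): 6-tuple 0.959/1.006/1.148, 4-tuple 0.980/1.009/1.088, 3-tuple 0.982/0.993/1.030,
pair 0.998/1.011/1.037, `X²+1` 1.002/1.010/1.023.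
VERDICT: no deviation from `λ_f(y)D^{y-1}Γ(y)^{-k}` on the new axis (independence across ≤ 6 coordinates, maximal local
correlation `ω_f(p) ∈ {0,4}`, degree 4); every rigid constant of the typed crux is the one the data select, and the
approach to the limit is the `1/log x` law an LSD theorem would give.
-/

/-! ## §7 (gen 3) The three crux-plan LINES under attack — stub census, base-case identities, consistency

Standing-adversary pass (refuter-cdisprove-stmt-Parity-11292-g3-0, 2026-08-16) over the 15 stubs of the three registered
skeletons `Cruxes/SystemLSDRealSegment/Lines/{sign-free-sieve-lab, ewens-pd-kernel, beta-thinned-root-kernel}.lean` with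
the cheap arsenal (degenerate parameters, typing/junk audit of every definition, quantifier order, small models,
forced-constant consistency). VERDICT: 0 stub-false, 0 stub-misstated; every OPEN stub is an honest restatement of the
crux's beyond-level-`x` content, and at the calibration family `f = (X)` the two "kernel" stubs are IDENTITIES
(kernel-checked below against VERBATIM copies of the lines' definitions: `EwensLine.kpd_X`, `BetaLine.betaKernelLawAt_X`).

STUB CENSUS (T = true / provable as billed, O = open ≙ the crux; with the attack that came closest):
* `sign-free-sieve-lab` — `stub_sliceMinorant` T (termwise `y^{s(m)} = Σ_{d∣m} h_y(d)`, `h_y ≥ 0`; `k = 0`, `θ ≤ 0`,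
  `x = 0` harmless for a minorant); `stub_eulerFactor` T (`E_p(y) = 1 + (y-1)ω_f(p)/p + O(p⁻²)` off the finitely many
  resultant/discriminant primes + the ordered AZFG convergence; `Λ(0) = C(f)` because
  `#{n mod p² : p ∤ ∏ fᵢ(n)} = p(p - ω_f(p))`); `stub_slicedKernel` O (for `θ < 1`, `k = 1` it is Type-I with constant
  `λ_f(y)θ^{y-1}/Γ(y)` — consistent with the model `G(θ) = Γ(y)^{-k}D^{y-1}P(Σ dᵢBᵢ ≤ θ)`; `θ ∈ (1, T)` IS the crux);
  `stub_topSliceTail` T modulo a vendored Nair–Tenenbaum/Henriot upper bound (relative tilted mass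
  `E[((y-1)/y)^{#{p > x^η}}] ≍ η/T`; upper bounds only, positivity essential); glue `tendsto_of_slices` is proved there.
* `ewens-pd-kernel` — `stub_eulerFactor` T (cpow of the positive real base `1 - p⁻¹`; at `z = 0`, `0^0 = 1` selects the
  coprime classes, so the partial product IS `batemanHornPartial f Y`; `z = 1`: every factor `1`; real `t > 0`: positive);
  `stub_smallPrimes` T (complete periods; the FULL `x^θ`-smooth sum is `x ∏_{p ≤ x^θ} E_p(t)` EXACTLY because
  `Σ_v h_t(p^v)ρ_f(p^v)/p^v = E_p(t)`; Rankin tail `e^{-η/θ + O(1)}`; `k = 0`: `|(x+1) - x| ≤ εx` ✓);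
  `stub_integerEwens` T (the corner constant `e^{-γ(t-1)}/Γ(t)` is the Ewens sampling normalisation —
  `E[x^{K_n}] = Γ(n+x)/(Γ(x)n!) ~ n^{x-1}/Γ(x)` against the unconditioned Poisson `n^{x-1}e^{γ(x-1)}`; `t = 2` check
  `Σ_{d ≤ X, P⁻(d) > X^a} μ²(d)/d ~ e^{-γ}/a` (Buchstab `ω(u) → e^{-γ}`) ✓; `t = 1` ✓; `a = b` forces `C(a,a,t) = 1` ✓);
  `stub_tiltedTails` T modulo Nair–Tenenbaum (two UPPER bounds; (b): `Σ_{m < x^κ} t^{s(m)}/m · x/log x ≍ κ^t ≤ κ` ✓);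
  `stub_kpd` O — but an IDENTITY for `(X)` (`EwensLine.kpd_X`: reality IS the model, the difference is `≡ 0` for every
  `x`, admissible `d`, `j`; the cofactor scale `⌊x^{deg}/dᵢ⌋` and the smoothness clause of `admissible` are exactly what
  make it exact — with the FIXED scale `mᵢ ≤ x^{dᵢ}` the statement would already be FALSE for `(X)` whenever `κ < η`:
  the window top `(x^{1-η}, x^{1-κ}]` is dead for cofactors `≤ x/d`, `d ≈ x^η`, a law discrepancy `≈ η - κ ↛ 0`; the
  triage r1-2 (i) repair is load-bearing); `stub_splice` T given the five inputs (sandwich `S_adm ≤ S ≤ S_adm+Tail+Top`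
  including the boundary conventions `p ≤ z` / `z < p` ✓; the `b ≤ 1` side condition of `IntegerEwens` wants `η < κ`
  strictly or `b` clamped at `1` — `windowCount z w m = windowCount z (min w X) m` for `m ≤ X`; harmless).
* `beta-thinned-root-kernel` — `stub_eulerFactor` T; `stub_rootMertens` T (Landau; irreducible of positive degree ⇒
  primitive); `stub_levinFainleib` T as typed (junk probes: `κ = 0`, `g = δ₁` ✓; one huge `g(2)` ✓; `(H2)` forces the
  prime-power mass to be summable, so the `tsum` Euler factor is never junk `0`; error `(log D)^{κ-1}` = HR Lemma 5.4's
  relative `O(1/log D)`); `stub_typeIReduction` T (error `Σ_{∏dᵢ ≤ x} ∏h · lcm · δ ≍ x(log x)^{κ-1}`);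
  `stub_betaKernel` O — its forced constant `λ_f(y)(D^{y-1}Γ(y)^{-k} - Γ(k(y-1)+1)^{-1})` is `≥ 0` for EVERY `k`,
  `D ≥ 1`, `y > 1` (`betaKernelConst_nonneg`: log-convexity of `Γ`, Bohr–Mollerup), `> 0` as soon as `D > 1`
  (`betaKernelConst_pos_of_one_lt`; for `D = 1`, `k ≥ 2` strictness is STRICT log-convexity of `Γ`, not in Mathlib —
  numerically `Γ(3/2)^{-2} - Γ(2)^{-1} = 0.2732` for the twins), and `= 0` with an EMPTY kernel for `(X)`
  (`BetaLine.kernelSum_X`, `BetaLine.betaKernelLawAt_X`). No sign kill; and the Type-I (level `≤ x`) part carries AT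
  MOST the share `Γ(y)^k D^{1-y}/Γ(k(y-1)+1) ≤ 1` of the predicted mass, `< 1` whenever `D > 1` (or `k ≥ 2`): no line
  avoids the divisor data of `fᵢ(n)` beyond level `x` — the crux's Type-I₂ wall as a Lean inequality
  (`typeIShare_le_one`, `typeIShare_lt_one`).

ADVERSARY'S COMPARISON OF THE THREE LINES (for the lead's pick; no line is refutable, this is about attack surface).
All three share `stub_eulerFactor` (size M; beta's form is the weakest — ball + `Λ(0)` only —, ewens' the strongest —
entire, `λ_f(1) = 1`, positivity —; a prover should land the strong form once and feed all three). `beta-thinned-root-kernel`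
reaches its open kernel only through two vendoring tasks (`LevinFainleib` L, `RootMertens` M) and an L-sized reduction, and
its kernel `BetaKernelLaw` is literally "crux minus the Type-I theorem" (no new structure; share `< 1` of the mass by
`typeIShare_lt_one`). `sign-free-sieve-lab` asks MORE than needed (`stub_slicedKernel` pins the whole `θ`-profile `G` on
`(0, T)`), but its slices are monotone in `θ`, so partial ranges (`θ ≤ 1`: Type-I + Wirsing) are certified partial theorems;
it needs a Nair–Tenenbaum vendoring for `stub_topSliceTail`. `ewens-pd-kernel` has the heaviest bookkeeping (six stubs,
`IntegerEwens` M–L of pure real analysis, NT vendoring) but the CLEANEST isolation of the arithmetic: `KPD` is `y`-free and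
law-level, exactly checkable at `(X)` (`EwensLine.kpd_X`) and by computation (its own falsifier `#{n ≤ x : P⁺(n²+1) > x}/x →
log 2`, kit j006851) — from the adversary's chair the most FALSIFIABLE kernel, which is a virtue. Common to all: the open
stub is the crux's beyond-level-`x` content and nothing less (Type-I₂ wall); none engages parity.

ALSO NEW (§7.1): the law is BLIND TO BOUNDED ORDER — the `n ≤ x` with `s_f(n) ≤ K` contribute `→ 0`
(`tendsto_boundedPart_zero`), in particular the prime tuples themselves (`stat_le_of_all_prime`): the crux cannot see the
Bateman–Horn count at all; its content is the `y`-tilted anatomy of the ALMOST-primes, and parity enters the route only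
through `SystemZeroRepulsion` (normality). Numerics on a new axis: §6bis (kit j009357 done; the `x ≤ 10⁷` run j009358 queued, auto-attaching to the item as
`compute-j009358.json`) — `Γ(y)^{-k}` independence for `k = 3, 4, 6` prime tuples and
the same-splitting-field pair `(X²+1, X²+9)` (`k = 2`, `D = 4`, `ω_f(p) ∈ {0, 4}`), `x ≤ 10⁷`.
-/

/-! ### §7.1 Blindness to bounded order -/

/-- BLINDNESS TO BOUNDED ORDER: for `k ≥ 1`, `y > 1` and any `K`, the `n ≤ x` with `s_f(n) ≤ K` contribute
`≤ x⁻¹(x+1) y^K (log x)^{k(1-y)} → 0` to the normalised sum. So the real-segment law is unchanged by ANY modification of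
the statistic on `{n : s_f(n) ≤ K}` — in particular it is independent of how many `n` make every `fᵢ(n)` prime. [folklore] -/
theorem tendsto_boundedPart_zero {k : ℕ} (hk : 1 ≤ k) (f : Fin k → ℤ[X]) {y : ℝ} (hy : 1 < y) (K : ℕ) :
    Tendsto (fun x : ℕ => (x : ℝ)⁻¹ * Real.exp (k * (1 - y) * Real.log (Real.log x)) *
      ∑ n ∈ (Finset.range (x + 1)).filter (fun n => stat f n ≤ K), y ^ stat f n) atTop (𝓝 0) := by
  have hy0 : 0 ≤ y := by linarith
  have hy1 : 1 ≤ y := hy.le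
  have hup : Tendsto (fun x : ℕ => (x : ℝ)⁻¹ * (x + 1) * Real.exp (k * (1 - y) * Real.log (Real.log x)) * y ^ K)
      atTop (𝓝 0) := by
    have := ((tendsto_inv_mul_succ.mul (tendsto_normaliser_zero hk hy)).mul_const (y ^ K))
    simpa using this
  refine tendsto_of_tendsto_of_tendsto_of_le_of_le tendsto_const_nhds hup (fun x => ?_) (fun x => ?_)
  · have : 0 ≤ ∑ n ∈ (Finset.range (x + 1)).filter (fun n => stat f n ≤ K), y ^ stat f n :=
      Finset.sum_nonneg fun _ _ => pow_nonneg hy0 _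
    positivity
  · have hsum : ∑ n ∈ (Finset.range (x + 1)).filter (fun n => stat f n ≤ K), y ^ stat f n ≤ (x + 1) * y ^ K := by
      calc ∑ n ∈ (Finset.range (x + 1)).filter (fun n => stat f n ≤ K), y ^ stat f n
          ≤ ∑ n ∈ (Finset.range (x + 1)).filter (fun n => stat f n ≤ K), y ^ K := by
            refine Finset.sum_le_sum fun n hn => ?_
            exact pow_le_pow_right₀ hy1 (Finset.mem_filter.1 hn).2
        _ = ((Finset.range (x + 1)).filter (fun n => stat f n ≤ K)).card * y ^ K := by
            rw [Finset.sum_const, nsmul_eq_mul]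
        _ ≤ (x + 1) * y ^ K := by
            gcongr
            have := Finset.card_filter_le (Finset.range (x + 1)) (fun n => stat f n ≤ K)
            rw [Finset.card_range] at this
            exact_mod_cast this
    have hpos : 0 ≤ (x : ℝ)⁻¹ * Real.exp (k * (1 - y) * Real.log (Real.log x)) := by positivity
    calc (x : ℝ)⁻¹ * Real.exp (k * (1 - y) * Real.log (Real.log x)) *
          ∑ n ∈ (Finset.range (x + 1)).filter (fun n => stat f n ≤ K), y ^ stat f n
        ≤ (x : ℝ)⁻¹ * Real.exp (k * (1 - y) * Real.log (Real.log x)) * ((x + 1) * y ^ K) :=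
          mul_le_mul_of_nonneg_left hsum hpos
      _ = (x : ℝ)⁻¹ * (x + 1) * Real.exp (k * (1 - y) * Real.log (Real.log x)) * y ^ K := by ring

/-- … in particular the `n` at which EVERY `fᵢ(n)` is prime — the Bateman–Horn count itself — have `s_f(n) ≤ k` and are
invisible to the crux. [folklore] -/
theorem stat_le_of_all_prime {k : ℕ} (f : Fin k → ℤ[X]) {n : ℕ}
    (h : ∀ i, (((f i).eval (n : ℤ)).toNat).Prime) : stat f n ≤ k := by
  unfold stat
  calc ∑ i, (((f i).eval (n : ℤ)).toNat.factorization.sum fun _ v => min v 2) ≤ ∑ _i : Fin k, 1 := by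
        refine Finset.sum_le_sum fun i _ => ?_
        rw [(h i).factorization, Finsupp.sum_single_index (by simp)]
        simp
    _ = k := by simp

/-! ### §7.2 Line `beta-thinned-root-kernel`: the forced kernel constant and the empty kernel of `(X)` -/

/-- Log-convexity of `Γ` (Bohr–Mollerup): `Γ(1+u)^k ≤ Γ(1+ku)` for `u ≥ 0`, `k ≥ 1`. [folklore] -/
theorem Gamma_one_add_pow_le (k : ℕ) (hk : 1 ≤ k) {u : ℝ} (hu : 0 ≤ u) :
    Real.Gamma (1 + u) ^ k ≤ Real.Gamma (1 + k * u) := by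
  have hk0 : (0 : ℝ) < k := by exact_mod_cast hk
  have hconv := Real.convexOn_log_Gamma
  have h1 : (1 : ℝ) ∈ Set.Ioi (0 : ℝ) := by simp
  have h2 : (1 + (k : ℝ) * u) ∈ Set.Ioi (0 : ℝ) := by
    simp only [Set.mem_Ioi]; positivity
  have ha : (0 : ℝ) ≤ 1 - 1 / k := by
    rw [sub_nonneg, div_le_one hk0]; exact_mod_cast hk
  have hb : (0 : ℝ) ≤ 1 / k := by positivity
  have hab : 1 - 1 / (k : ℝ) + 1 / k = 1 := by ring
  have key := hconv.2 h1 h2 ha hb hab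
  simp only [Function.comp_apply, smul_eq_mul, Real.Gamma_one, Real.log_one, mul_zero, zero_add] at key
  have hpt : (1 - 1 / (k : ℝ)) * 1 + 1 / k * (1 + k * u) = 1 + u := by
    field_simp; ring
  rw [hpt] at key
  have hG1 : 0 < Real.Gamma (1 + u) := Real.Gamma_pos_of_pos (by linarith)
  have hG2 : 0 < Real.Gamma (1 + k * u) := Real.Gamma_pos_of_pos (by positivity)
  have key' : (k : ℝ) * Real.log (Real.Gamma (1 + u)) ≤ Real.log (Real.Gamma (1 + k * u)) := by
    have := mul_le_mul_of_nonneg_left key hk0.le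
    rwa [← mul_assoc, mul_one_div_cancel hk0.ne', one_mul] at this
  rw [← Real.log_pow] at key'
  exact (Real.log_le_log_iff (pow_pos hG1 k) hG2).1 key'

/-- CONSISTENCY OF `BetaKernelLaw` (line `beta-thinned-root-kernel`): its forced constant
`D^{y-1}Γ(y)^{-k} - Γ(k(y-1)+1)^{-1}` (times `λ_f(y) > 0`) is `≥ 0` for EVERY `k`, real `D ≥ 1`, `y > 1` — as it must be,
the kernel `K_x(y)` being a sum of non-negative terms. No sign kill of the open stub. (Real form of the line's
`archFactor`: `e^{(y-1) log D}(Γ(y)⁻¹)^k`.) [folklore] -/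
theorem betaKernelConst_nonneg (k : ℕ) {D y : ℝ} (hD : 1 ≤ D) (hy : 1 < y) :
    (Real.Gamma (k * (y - 1) + 1))⁻¹ ≤ Real.exp ((y - 1) * Real.log D) * (Real.Gamma y)⁻¹ ^ k := by
  have hGy : 0 < Real.Gamma y := Real.Gamma_pos_of_pos (by linarith)
  have hexp : 1 ≤ Real.exp ((y - 1) * Real.log D) :=
    Real.one_le_exp (mul_nonneg (by linarith) (Real.log_nonneg hD))
  rcases Nat.eq_zero_or_pos k with rfl | hk
  · simp only [Nat.cast_zero, zero_mul, zero_add, Real.Gamma_one, inv_one, pow_zero, mul_one]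
    exact hexp
  have hle := Gamma_one_add_pow_le k hk (u := y - 1) (by linarith)
  rw [show (1 : ℝ) + (y - 1) = y by ring, add_comm] at hle
  have hGk : 0 < Real.Gamma y ^ k := pow_pos hGy k
  calc (Real.Gamma ((k : ℝ) * (y - 1) + 1))⁻¹ ≤ (Real.Gamma y ^ k)⁻¹ := by
        rw [show (k : ℝ) * (y - 1) + 1 = 1 + k * (y - 1) by ring]
        exact inv_anti₀ hGk (by rw [add_comm]; simpa [add_comm] using hle)
    _ = 1 * (Real.Gamma y)⁻¹ ^ k := by rw [inv_pow, one_mul]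
    _ ≤ Real.exp ((y - 1) * Real.log D) * (Real.Gamma y)⁻¹ ^ k := by
        gcongr

/-- … and STRICTLY positive as soon as `D = ∏ deg fᵢ > 1`: the beyond-level kernel then carries a positive share of the
predicted mass. (For `D = 1`, `k ≥ 2` — prime tuples — strictness is strict log-convexity of `Γ`, numerically
`Γ(3/2)^{-2} - Γ(2)^{-1} = 0.2732`; not formalised.) [folklore] -/
theorem betaKernelConst_pos_of_one_lt (k : ℕ) {D y : ℝ} (hD : 1 < D) (hy : 1 < y) :
    (Real.Gamma (k * (y - 1) + 1))⁻¹ < Real.exp ((y - 1) * Real.log D) * (Real.Gamma y)⁻¹ ^ k := by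
  have hGy : 0 < Real.Gamma y := Real.Gamma_pos_of_pos (by linarith)
  have hexp : 1 < Real.exp ((y - 1) * Real.log D) :=
    Real.one_lt_exp_iff.2 (mul_pos (by linarith) (Real.log_pos hD))
  have h1 := betaKernelConst_nonneg k (le_refl (1 : ℝ)) hy
  rw [Real.log_one, mul_zero, Real.exp_zero, one_mul] at h1
  have hpos : 0 < (Real.Gamma y)⁻¹ ^ k := pow_pos (inv_pos.2 hGy) k
  calc (Real.Gamma ((k : ℝ) * (y - 1) + 1))⁻¹ ≤ (Real.Gamma y)⁻¹ ^ k := h1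
    _ = 1 * (Real.Gamma y)⁻¹ ^ k := (one_mul _).symm
    _ < Real.exp ((y - 1) * Real.log D) * (Real.Gamma y)⁻¹ ^ k := by gcongr

/-- THE TYPE-I SHARE IS AT MOST ONE: the level-`x` divisor part of line `beta-thinned-root-kernel` (`TypeILaw`,
constant `λ_f(y)/Γ(k(y-1)+1)`) against the crux's prediction `λ_f(y)D^{y-1}Γ(y)^{-k}` — the ratio
`Γ(k(y-1)+1)^{-1} / (D^{y-1}Γ(y)^{-k}) ≤ 1`. [folklore] -/
theorem typeIShare_le_one (k : ℕ) {D y : ℝ} (hD : 1 ≤ D) (hy : 1 < y) :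
    (Real.Gamma (k * (y - 1) + 1))⁻¹ / (Real.exp ((y - 1) * Real.log D) * (Real.Gamma y)⁻¹ ^ k) ≤ 1 := by
  have hGy : 0 < Real.Gamma y := Real.Gamma_pos_of_pos (by linarith)
  have hden : 0 < Real.exp ((y - 1) * Real.log D) * (Real.Gamma y)⁻¹ ^ k := by positivity
  rw [div_le_one hden]
  exact betaKernelConst_nonneg k hD hy

/-- … and STRICTLY less than one when `D > 1`: for every Bateman–Horn system with a non-linear member, a positive share
`1 - Γ(y)^k D^{1-y}/Γ(k(y-1)+1)` of the predicted mass sits in divisor tuples BEYOND level `x` (e.g. `1 - 2^{1-y} ≈ 29 %`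
for `X² + 1` at `y = 3/2`) — the crux's Type-I₂ wall as an inequality. [folklore] -/
theorem typeIShare_lt_one (k : ℕ) {D y : ℝ} (hD : 1 < D) (hy : 1 < y) :
    (Real.Gamma (k * (y - 1) + 1))⁻¹ / (Real.exp ((y - 1) * Real.log D) * (Real.Gamma y)⁻¹ ^ k) < 1 := by
  have hGy : 0 < Real.Gamma y := Real.Gamma_pos_of_pos (by linarith)
  have hden : 0 < Real.exp ((y - 1) * Real.log D) * (Real.Gamma y)⁻¹ ^ k := by positivity
  rw [div_lt_one hden]
  exact betaKernelConst_pos_of_one_lt k hD hy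

namespace BetaLine

/-! Verbatim copies (from `Lines/beta-thinned-root-kernel.lean`, which cannot be imported: it carries the stubs'
`sorry`s) of the objects needed to state `BetaKernelLaw` for one family. -/

section Weights
variable {R : Type*} [CommRing R]

/-- [line copy] local coefficients of the thinned weight. -/
def thinCoeff (y : R) : ℕ → R
  | 0 => 1
  | 1 => y - 1
  | 2 => y ^ 2 - y
  | _ => 0

/-- [line copy] the thinned divisor weight `h_y`. -/
def thinWeight (y : R) (d : ℕ) : R := d.factorization.prod fun _ v => thinCoeff y v

end Weights

/-- [line copy] divisors with `0 ↦ {1}`. -/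
def divSet (m : ℕ) : Finset ℕ := (max m 1).divisors

/-- [line copy] divisor tuples of the values at `n`. -/
def tuples {k : ℕ} (f : Fin k → ℤ[X]) (n : ℕ) : Finset (Fin k → ℕ) :=
  Fintype.piFinset fun i => divSet ((f i).eval (n : ℤ)).toNat

/-- [line copy] the beyond-level kernel `K_x(y)`. -/
def kernelSum {k : ℕ} (f : Fin k → ℤ[X]) (y : ℝ) (x : ℕ) : ℝ :=
  ∑ n ∈ range (x + 1), ∑ d ∈ (tuples f n).filter (fun d => x < ∏ i, d i), ∏ i, thinWeight y (d i)

/-- [line copy] capped `p`-adic order read mod `p²`. -/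
def localExp (p : ℕ) (m : ℤ) : ℕ :=
  if (p : ℤ) ^ 2 ∣ m then 2 else if (p : ℤ) ∣ m then 1 else 0

/-- [line copy] local factor `E_p(z)`. -/
def localFactor {k : ℕ} (f : Fin k → ℤ[X]) (p : ℕ) (z : ℂ) : ℂ :=
  ((p : ℂ) ^ 2)⁻¹ * ∑ n ∈ range (p ^ 2), z ^ (∑ i, localExp p ((f i).eval (n : ℤ)))

/-- [line copy] the explicit Euler factor `λ_f`. -/
def eulerFactor {k : ℕ} (f : Fin k → ℤ[X]) (z : ℂ) : ℂ :=
  limUnder atTop fun N : ℕ => ∏ p ∈ Nat.primesLE N,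
    localFactor f p z * Complex.exp ((k : ℂ) * (z - 1) * (Real.log (1 - 1 / (p : ℝ)) : ℂ))

/-- The body of the line's `BetaKernelLaw` for ONE family `(k, f)` (verbatim). -/
def BetaKernelLawAt (k : ℕ) (f : Fin k → ℤ[X]) : Prop :=
  ∀ y : ℝ, 5 / 4 < y → y < 7 / 4 →
    Tendsto (fun x : ℕ => (x : ℂ)⁻¹ * Complex.exp ((k : ℂ) * (1 - (y : ℂ)) * (Real.log (Real.log x) : ℂ)) *
        (kernelSum f y x : ℂ)) atTop
      (𝓝 (eulerFactor f y *
        (Complex.exp (((y : ℂ) - 1) * (Real.log (∏ i, ((f i).natDegree : ℝ)) : ℂ)) * (Complex.Gamma y)⁻¹ ^ k -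
          (Complex.Gamma ((k : ℂ) * ((y : ℂ) - 1) + 1))⁻¹)))

/-- CALIBRATION: no divisor tuple of `(X)` at `n ≤ x` lies beyond level `x` — the kernel of `(X)` is EMPTY (`x ≥ 1`; at
`x = 0` the junk tuple `d = 1 ∈ divSet 0 = {1}` satisfies `0 < 1`, `K_0 = 1`). [folklore] -/
theorem kernelSum_X {y : ℝ} {x : ℕ} (hx : 1 ≤ x) : kernelSum ![(X : ℤ[X])] y x = 0 := by
  unfold kernelSum
  refine Finset.sum_eq_zero fun n hn => Finset.sum_eq_zero fun d hd => ?_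
  exfalso
  rw [Finset.mem_filter, tuples, Fintype.mem_piFinset] at hd
  obtain ⟨hd, hlt⟩ := hd
  have h0 := hd 0
  simp only [Matrix.cons_val_zero, eval_X, Int.toNat_natCast, divSet] at h0
  rw [Fin.prod_univ_one] at hlt
  have hle : d 0 ≤ max n 1 := Nat.divisor_le h0
  have hn' : n ≤ x := by have := Finset.mem_range.1 hn; omega
  have : max n 1 ≤ x := max_le hn' hx
  omega

/-- The forced kernel constant of `(X)` vanishes: `D = 1`, `k = 1`, `e^{0}Γ(y)^{-1} - Γ(1·(y-1)+1)^{-1} = 0`. [folklore] -/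
theorem betaKernelConst_X (y : ℝ) :
    Complex.exp (((y : ℂ) - 1) * (Real.log (∏ i : Fin 1, ((![(X : ℤ[X])] i).natDegree : ℝ)) : ℂ)) *
        (Complex.Gamma y)⁻¹ ^ 1 - (Complex.Gamma (((1 : ℕ) : ℂ) * ((y : ℂ) - 1) + 1))⁻¹ = 0 := by
  simp

/-- **`BetaKernelLaw` HOLDS for `f = (X)`** (both sides `0`): the line's open stub has no content in the linear `k = 1`
case, as its docstring claims — the stub's content begins at `D ≥ 2` or `k ≥ 2` (`typeIShare_lt_one`). [folklore] -/
theorem betaKernelLawAt_X : BetaKernelLawAt 1 ![(X : ℤ[X])] := by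
  intro y _ _
  rw [betaKernelConst_X, mul_zero]
  refine (tendsto_const_nhds (x := (0 : ℂ))).congr' ?_
  filter_upwards [eventually_ge_atTop 1] with x hx
  rw [kernelSum_X hx]
  simp

end BetaLine

/-! ### §7.3 Line `ewens-pd-kernel`: the kernel `KPD` is an IDENTITY for `(X)` -/

namespace EwensLine

/-! Verbatim copies (from `Lines/ewens-pd-kernel.lean`) of the objects needed to state `KPD`. -/

/-- [line copy] windowed capped count. -/
def windowCount (z w : ℝ) (m : ℕ) : ℕ :=
  m.factorization.sum fun p v => if z < (p : ℝ) ∧ (p : ℝ) ≤ w then min v 2 else 0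

/-- [line copy] the `i`-th value as a natural number. -/
def val {k : ℕ} (f : Fin k → ℤ[X]) (i : Fin k) (n : ℕ) : ℕ :=
  ((f i).eval (n : ℤ)).toNat

/-- [line copy] admissible divisor tuples. -/
def admissible (k : ℕ) (θ η : ℝ) (x : ℕ) : Finset (Fin k → ℕ) :=
  (Fintype.piFinset fun _ : Fin k => Icc 1 x).filter fun d =>
    (∏ i, (d i : ℝ)) ≤ (x : ℝ) ^ η ∧ ∀ i, ∀ p ∈ (d i).primeFactors, (p : ℝ) ≤ (x : ℝ) ^ θ

/-- [line copy] the divisor class `A_d(x)`. -/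
def divClass {k : ℕ} (f : Fin k → ℤ[X]) (d : Fin k → ℕ) (x : ℕ) : Finset ℕ :=
  (range (x + 1)).filter fun n : ℕ => ∀ i, 0 < (f i).eval (n : ℤ) ∧ ((d i : ℕ) : ℤ) ∣ (f i).eval (n : ℤ)

/-- [line copy] the windowed large-prime count of the system. -/
def sysWindowCount {k : ℕ} (f : Fin k → ℤ[X]) (θ κ : ℝ) (x n : ℕ) : ℕ :=
  ∑ i, windowCount ((x : ℝ) ^ θ) ((x : ℝ) ^ (((f i).natDegree : ℝ) - κ)) (val f i n)

/-- [line copy] the integer model, law form. -/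
def modelLaw {k : ℕ} (X : Fin k → ℕ) (z : ℝ) (w : Fin k → ℝ) (j : ℕ) : ℝ :=
  (∏ i, (X i : ℝ))⁻¹ *
    (#((Fintype.piFinset fun i => Icc 1 (X i)).filter fun m => ∑ i, windowCount z (w i) (m i) = j) : ℝ)

/-- [line copy] the kernel `KPD k f`. -/
def KPD (k : ℕ) (f : Fin k → ℤ[X]) : Prop :=
  ∃ η₀ : ℝ, 0 < η₀ ∧ ∀ θ η κ : ℝ, 0 < θ → θ < η → η ≤ η₀ → 0 < κ → κ ≤ η₀ →
    ∀ ε : ℝ, 0 < ε → ∀ᶠ x : ℕ in atTop, ∀ d ∈ admissible k θ η x, ∀ j : ℕ,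
      |(#((divClass f d x).filter fun n : ℕ => sysWindowCount f θ κ x n = j) : ℝ) -
          (#(divClass f d x) : ℝ) *
            modelLaw (fun i => ⌊(x : ℝ) ^ ((f i).natDegree : ℝ) / (d i : ℝ)⌋₊) ((x : ℝ) ^ θ)
              (fun i => (x : ℝ) ^ (((f i).natDegree : ℝ) - κ)) j| ≤
        ε * (#(divClass f d x) : ℝ)

/-- Multiplying by a `z`-smooth `d` does not change the count of prime factors in a window above `z`. [folklore] -/
theorem windowCount_mul_of_smooth {z w : ℝ} {d m : ℕ} (hd : d ≠ 0) (hm : m ≠ 0)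
    (hsmooth : ∀ p ∈ d.primeFactors, (p : ℝ) ≤ z) :
    windowCount z w (d * m) = windowCount z w m := by
  unfold windowCount
  set F : ℕ → ℕ → ℕ := fun p v => if z < (p : ℝ) ∧ (p : ℝ) ≤ w then min v 2 else 0 with hF
  have hF0 : ∀ p, F p 0 = 0 := fun p => by simp [hF]
  set S := (d * m).primeFactors with hS
  have h1 : (d * m).factorization.sum F = ∑ p ∈ S, F p ((d * m).factorization p) :=
    Finsupp.sum_of_support_subset _ (by rw [Nat.support_factorization]) _ fun p _ => hF0 p
  have h2 : m.factorization.sum F = ∑ p ∈ S, F p (m.factorization p) := by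
    refine Finsupp.sum_of_support_subset _ ?_ _ fun p _ => hF0 p
    rw [Nat.support_factorization, hS]
    exact Nat.primeFactors_mono (dvd_mul_left m d) (mul_ne_zero hd hm)
  rw [h1, h2]
  refine Finset.sum_congr rfl fun p hp => ?_
  rw [Nat.factorization_mul hd hm, Finsupp.add_apply]
  by_cases hz : z < (p : ℝ) ∧ (p : ℝ) ≤ w
  · have hpd : d.factorization p = 0 := by
      rcases Nat.eq_zero_or_pos (d.factorization p) with h | h
      · exact h
      · exfalso
        have hmem : p ∈ d.primeFactors := by
          rw [← Nat.support_factorization, Finsupp.mem_support_iff]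
          exact h.ne'
        have := hsmooth p hmem
        linarith [hz.1]
    rw [hpd, zero_add]
  · simp [hF, hz]

/-- For `(X)` the system count is the windowed count of `n` itself. [folklore] -/
theorem sysWindowCount_X (θ κ : ℝ) (x n : ℕ) :
    sysWindowCount ![(X : ℤ[X])] θ κ x n = windowCount ((x : ℝ) ^ θ) ((x : ℝ) ^ ((1 : ℝ) - κ)) n := by
  simp [sysWindowCount, val]

/-- The divisor class of `(X)` at `d`: the positive multiples of `d 0` up to `x`. [folklore] -/
theorem mem_divClass_X (d : Fin 1 → ℕ) (x n : ℕ) :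
    n ∈ divClass ![(X : ℤ[X])] d x ↔ n ≤ x ∧ 0 < n ∧ d 0 ∣ n := by
  simp only [divClass, Finset.mem_filter, Finset.mem_range, Fin.forall_fin_one, Matrix.cons_val_zero, eval_X,
    Int.natCast_dvd_natCast]
  constructor
  · rintro ⟨h1, h2, h3⟩
    exact ⟨by omega, by exact_mod_cast h2, h3⟩
  · rintro ⟨h1, h2, h3⟩
    exact ⟨by omega, by exact_mod_cast h2, h3⟩

/-- … = the image of `[1, x / d₀]` under `m ↦ d₀ m` (the cofactor IS a uniform integer `≤ ⌊x/d₀⌋`). [folklore] -/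
theorem divClass_X_eq_image (d : Fin 1 → ℕ) (x : ℕ) (hd : 0 < d 0) :
    divClass ![(X : ℤ[X])] d x = (Icc 1 (x / d 0)).image fun m => d 0 * m := by
  ext n
  rw [mem_divClass_X, Finset.mem_image]
  constructor
  · rintro ⟨hn, hn0, ⟨m, rfl⟩⟩
    refine ⟨m, Finset.mem_Icc.2 ⟨?_, ?_⟩, rfl⟩
    · rcases Nat.eq_zero_or_pos m with rfl | hm
      · simp at hn0
      · exact hm
    · rw [Nat.le_div_iff_mul_le hd, mul_comm]
      exact hn
  · rintro ⟨m, hm, rfl⟩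
    rw [Finset.mem_Icc] at hm
    refine ⟨?_, Nat.mul_pos hd (by omega), dvd_mul_right _ _⟩
    have := (Nat.le_div_iff_mul_le hd).1 hm.2
    rw [mul_comm]
    exact this

/-- `#A_d(x) = ⌊x / d₀⌋` for `(X)`. [folklore] -/
theorem card_divClass_X (d : Fin 1 → ℕ) (x : ℕ) (hd : 0 < d 0) : #(divClass ![(X : ℤ[X])] d x) = x / d 0 := by
  rw [divClass_X_eq_image d x hd, Finset.card_image_of_injective _ (mul_right_injective₀ hd.ne'), Nat.card_Icc]
  simp

/-- Reality side: the law of the windowed count on the class of `(X)` = the law on the cofactors `m ≤ x / d₀`, because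
the `x^θ`-smooth `d₀` is invisible in the window. [folklore] -/
theorem card_filter_divClass_X (d : Fin 1 → ℕ) (x : ℕ) (hd : 0 < d 0) (θ κ : ℝ)
    (hsmooth : ∀ p ∈ (d 0).primeFactors, (p : ℝ) ≤ (x : ℝ) ^ θ) (j : ℕ) :
    #((divClass ![(X : ℤ[X])] d x).filter fun n : ℕ => sysWindowCount ![(X : ℤ[X])] θ κ x n = j) =
      #((Icc 1 (x / d 0)).filter fun m : ℕ =>
        windowCount ((x : ℝ) ^ θ) ((x : ℝ) ^ ((1 : ℝ) - κ)) m = j) := by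
  rw [divClass_X_eq_image d x hd, Finset.filter_image,
    Finset.card_image_of_injective _ (mul_right_injective₀ hd.ne')]
  congr 1
  refine Finset.filter_congr fun m hm => ?_
  rw [Finset.mem_Icc] at hm
  simp only [sysWindowCount_X]
  rw [windowCount_mul_of_smooth hd.ne' (by omega) hsmooth]

/-- Model side: for `k = 1` the model law is the law of ONE uniform integer `m ≤ X₀`. [folklore] -/
theorem modelLaw_fin_one (X₀ : ℕ) (z w : ℝ) (j : ℕ) :
    modelLaw (fun _ : Fin 1 => X₀) z (fun _ => w) j =
      (X₀ : ℝ)⁻¹ * (#((Icc 1 X₀).filter fun m : ℕ => windowCount z w m = j) : ℝ) := by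
  unfold modelLaw
  simp only [Fin.prod_univ_one, Fin.sum_univ_one]
  congr 2
  refine Finset.card_bij' (fun m _ => m 0) (fun a _ => fun _ => a) (fun m hm => ?_) (fun a ha => ?_)
    (fun m _ => ?_) (fun a _ => rfl)
  · rw [Finset.mem_filter, Fintype.mem_piFinset] at hm
    exact Finset.mem_filter.2 ⟨hm.1 0, hm.2⟩
  · rw [Finset.mem_filter] at ha
    exact Finset.mem_filter.2 ⟨Fintype.mem_piFinset.2 fun _ => ha.1, ha.2⟩
  · funext i
    rw [Fin.fin_one_eq_zero i]

/-- The cofactor scale of `KPD` for `(X)`: `⌊x^{deg X} / d₀⌋ = x / d₀`. [folklore] -/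
theorem floor_scale_X (x d₀ : ℕ) :
    ⌊(x : ℝ) ^ (((X : ℤ[X])).natDegree : ℝ) / (d₀ : ℝ)⌋₊ = x / d₀ := by
  rw [natDegree_X, Nat.cast_one, Real.rpow_one, Nat.floor_div_natCast, Nat.floor_natCast]

/-- **`KPD` IS AN IDENTITY FOR `f = (X)`**: for every `x`, every admissible `d` and every `j`, the class count equals
`#A_d(x) · P_model(j)` EXACTLY — reality IS the model (the cofactor `n/d₀` is a uniform integer `≤ ⌊x/d₀⌋` and the
`x^θ`-smooth `d₀` is invisible in the window `(x^θ, x^{1-κ}]`). The cofactor scale `⌊x^{deg}/dᵢ⌋` (triage r1-2 (i)) is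
what makes this exact; with the FIXED scale `x^{deg}` it would fail for `κ < η`. [folklore] -/
theorem kpd_X_exact (θ η κ : ℝ) (x : ℕ) (d : Fin 1 → ℕ) (hd : d ∈ admissible 1 θ η x) (j : ℕ) :
    (#((divClass ![(X : ℤ[X])] d x).filter fun n : ℕ => sysWindowCount ![(X : ℤ[X])] θ κ x n = j) : ℝ) =
      (#(divClass ![(X : ℤ[X])] d x) : ℝ) *
        modelLaw (fun i => ⌊(x : ℝ) ^ (((![(X : ℤ[X])]) i).natDegree : ℝ) / (d i : ℝ)⌋₊) ((x : ℝ) ^ θ)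
          (fun i => (x : ℝ) ^ ((((![(X : ℤ[X])]) i).natDegree : ℝ) - κ)) j := by
  rw [admissible, Finset.mem_filter, Fintype.mem_piFinset] at hd
  obtain ⟨hd1, -, hsm⟩ := hd
  have hd0 : 0 < d 0 := by have := Finset.mem_Icc.1 (hd1 0); omega
  have hfun1 : (fun i : Fin 1 => ⌊(x : ℝ) ^ (((![(X : ℤ[X])]) i).natDegree : ℝ) / (d i : ℝ)⌋₊) = fun _ => x / d 0 := by
    funext i
    rw [Fin.fin_one_eq_zero i]
    simp only [Matrix.cons_val_zero]
    exact floor_scale_X x (d 0)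
  have hfun2 : (fun i : Fin 1 => (x : ℝ) ^ ((((![(X : ℤ[X])]) i).natDegree : ℝ) - κ)) =
      fun _ => (x : ℝ) ^ ((1 : ℝ) - κ) := by
    funext i
    rw [Fin.fin_one_eq_zero i]
    simp
  rw [hfun1, hfun2, modelLaw_fin_one, card_filter_divClass_X d x hd0 θ κ (hsm 0) j, card_divClass_X d x hd0]
  rcases Nat.eq_zero_or_pos (x / d 0) with h0 | hpos
  · rw [h0]
    simp
  · have : ((x / d 0 : ℕ) : ℝ) ≠ 0 := by exact_mod_cast hpos.ne'
    rw [← mul_assoc, mul_inv_cancel₀ this, one_mul]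

/-- Hence `KPD 1 (X)` HOLDS (any `η₀`; the difference is identically `0`) — the kernel stub of line `ewens-pd-kernel` is
consistent at its base and its content begins at `deg ≥ 2` or `k ≥ 2`. [folklore] -/
theorem kpd_X : KPD 1 ![(X : ℤ[X])] := by
  refine ⟨1, one_pos, fun θ η κ _ _ _ _ _ ε hε => Eventually.of_forall fun x d hd j => ?_⟩
  rw [kpd_X_exact θ η κ x d hd j, sub_self, abs_zero]
  positivity

end EwensLine

/-- Index theorem (trivial): the file's negative knowledge in one conjunction — three load-bearing fields, the
consistent degenerate cases, the refuted Ω-strengthening, and (gen 3) the two kernel stubs of the lines as identities at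
`(X)`. [folklore] -/
theorem summary : ¬WithoutLeadingCoeffPos ∧ ¬WithoutIrreducible ∧ ¬WithoutPairwiseNotAssociated ∧
    (∀ f : Fin 0 → ℤ[X], Conclusion 0 f) ∧ Conclusion 1 ![(C 3 : ℤ[X])] ∧ ¬OmegaLawWide ∧
    EwensLine.KPD 1 ![(X : ℤ[X])] ∧ BetaLine.BetaKernelLawAt 1 ![(X : ℤ[X])] :=
  ⟨false_without_leadingCoeff_pos, false_without_irreducible, false_without_pairwise_not_associated,
    conclusion_fin_zero, conclusion_C_three, not_omegaLawWide, EwensLine.kpd_X, BetaLine.betaKernelLawAt_X⟩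

end

end Summit.Parity.BatemanHorn.Cruxes.SystemLSDRealSegment.Disproof
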